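import Mathlib
import HarnessLib
import Literature.Combinatorics.Additive.SumsetSubmultiplicativity

/-!
# The Uniform Cover Inequality (Bollobás–Thomason) for finite point sets and for sumsets
# (Balister–Bollobás 2012, eq. (3) "(UC-latt)" and Theorem 8), and uniform-cover
# superadditivity (Balister–Bollobás 2012, Theorem 10)

Topic `Literature/Combinatorics/Additive`.  Cell `mm-stpp` (D-0046), seat `mm-stpp-lit` (gen 11);
companion of `SumsetSubmultiplicativity.lean` (Gyarmati–Matolcsi–Ruzsa 2010 Lemma 3.1 = the
Loomis–Whitney cover, and Thm 1.2), whose Hölder step `LoomisWhitney.pow_sum_le_mul_prod_sum` is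
reused here.  Everything in this file is PROVED (no named facts).

**Definitions (Balister–Bollobás 2012, §2).**  "We call a multiset `𝒜` of subsets of `[n]` such that
each element `i ∈ [n]` is in at least `k` of the members of `𝒜` a `k`-cover of `[n]`.  A `k`-uniform
cover or uniform `k`-cover is one in which every element is in precisely `k` members of `𝒜`.  Thus
the sets `[n] ∖ {i}` appearing in the Loomis–Whitney inequality form an `(n−1)`-uniform cover of
`[n]`." — `UniformCover.IsCover`, `UniformCover.IsUniformCover` (families `ι → Finset (Fin n)`
indexed by a `Fintype`, multiplicity counted with `univ.filter`), `isUniformCover_compl_singleton`;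
the projection `S ↦ S_A` is `UniformCover.proj A` (valued in `Fin n → Option X`).

**Theorem (Uniform Cover Inequality for lattice/point sets; Bollobás–Thomason 1995, BB 2012 §2
eq. (3) "(UC-latt)").**  "If `S` is a finite subset of `ℤⁿ` and `S_A` is the projection of `S` to
the subspace spanned by `{eᵢ : i ∈ A}`, then for every uniform `k`-cover `𝒜` of `[n]` we have
`|S|ᵏ ≤ ∏_{A∈𝒜} |S_A|`.  In fact, in this inequality we do not have to demand that the `k`-cover is
uniform." — `UniformCover.pow_card_le_prod_card_image_proj_of_nonempty` (any coordinate type `X`,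
any `k`-cover, `S ≠ ∅`), `UniformCover.pow_card_le_prod_card_image_proj` (`k ≠ 0`, any `S`),
`UniformCover.pow_card_le_prod_card_image_proj_of_isUniformCover` (as printed).  BB derive
(UC-latt) from the Box Theorem for bodies via unit cubes; the proof here is the direct discrete
induction on `n` (slice along a coordinate, induction hypothesis with the induced cover on each
slice, Hölder over `k` members containing the coordinate) — i.e. the argument GMR 2010 print for
Lemma 3.1, run for a general cover.

**Theorem (BB 2012, Thm 8 — Uniform Cover Inequality for sumsets).**  "Let `S₁, …, S_n` be finite
sets in a commutative semigroup with sum `S = S₁ + ⋯ + S_n`.  For `A ⊆ [n]` set `S_A = ∑_{i∈A} S_i`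
… if `𝒜` is a uniform `k`-cover of `[n]` then `|S|ᵏ ≤ ∏_{A∈𝒜} |S_A|`." —
`pow_card_sum_le_prod_card_subsum` (uniform covers, arbitrary finite `S_i`, every `k`) and
`pow_card_sum_le_prod_card_subsum_of_isCover` (`k`-covers, non-empty `S_i`), in an additive
commutative monoid (a commutative semigroup embeds in one by adjoining a zero; the monoid supplies
`∑` and the empty subsum `S_∅ = {0}`).  Proof as printed (§5): lexicographically least
representations `f(s) ∈ S₁ × ⋯ × S_n` (GMR's device, as in `SumsetSubmultiplicativity.lean`),
`|f(S)| = |S|`, the coordinate-sum map on `f(S)_A` is injective into `S_A`, and (UC-latt).  The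
Loomis–Whitney cover gives back GMR 2010 Thm 1.2 (`pow_card_sum_le_prod_card_sum_compl_singleton`;
cf. `pow_card_sum_le_prod_card_sum_erase`).
**Fractional coverings (Madiman–Marcus–Tetali 2012, Cor 3 and Cor 2; BB 2012 §2 "multisets").**
"Let `α` be a fractional covering using the hypergraph `𝒮` on `[k]` [`α ≥ 0`,
`∑_{s∋i} α_s ≥ 1`].  Let `X₁, …, X_k` be arbitrary finite sets, and `Y ⊂ X_{[k]}`.  Then
`|Y| ≤ ∏_{s∈𝒮} |π_s(Y)|^{α_s}`" — `UniformCover.card_le_prod_card_image_proj_rpow` (real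
exponents), via the multiset form `UniformCover.pow_card_le_prod_card_image_proj_pow_of_nonempty`
(`|B|ᵏ ≤ ∏_a |B_{𝒜 a}|^{w_a}` for integer weights covering every coordinate `≥ k` times), rounding
`q α` up and letting `q → ∞` (not the printed entropy proof); and for sumsets (MMT Cor 2 with
`f` = sum, their §3.4) `|S₁ + ⋯ + S_n| ≤ ∏_a |∑_{i∈𝒜 a} S_i|^{β_a}` — `card_sum_le_prod_card_subsum_rpow`,
through the representation lemma `exists_repr_card_image_proj_le` (GMR's lexicographic device,
"`|(S′)_A| ≤ |S_A|`", factored out of the proof of Theorem 8; appended 2026-08-27).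

**Theorem (BB 2012, Thm 10 — uniform-cover superadditivity, torsion-free groups).**  "If the
sets `S_i` lie in a torsion-free abelian group then there are subsets `S′_i ⊆ S_i` of cardinality
at most `2` such that for any uniform `k`-cover `𝒜` of `[n]` we have
`k(|S| − 1) ≥ k(|S′| − 1) ≥ ∑_{A∈𝒜} (|S_A| − 1)`, where `S′` is the set of sums `s₁ + ⋯ + s_n ∈ S`
such that `{i : s_i ∉ S′_i} ⊆ A` for some `A ∈ 𝒜`." — `exists_pair_subsets_sum_card_subsum_le`
(as printed; appended, see the section docstring below), from the linearly-ordered-group form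
`sum_card_subsum_le_of_isUniformCover` (`S′_i = {min S_i, max S_i}`; core marking inequality
`sum_card_subsum_le_of_isUniformCover_core`, weak form `sum_card_subsum_le_mul_card_sum`).  This
generalises GMR 2010 Thm 1.1 / 1.3 (`gmr_superadditivity_biUnion`,
`gmr_superadditivity_of_isAddTorsionFree` in `SumsetSuperadditivity.lean` = the Loomis–Whitney
cover).
**MMT 2012 Cor 4 ("Illustrative Set Result") for the full sumset.**  "If `𝒮` is a `r`-regular
hypergraph, then for any `D ⊆ B⁺_{[k]}`, `|A + D|^{|𝒮|} ≤ |D|^{|𝒮|−r} ∏_{s∈𝒮} |A + B⁺_s|`" in the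
case `D = B⁺_{[k]} = B₁ + ⋯ + B_k`, where the printed proof is valid —
`card_add_sum_pow_le_of_isUniformCover` (an instance of Theorem 8; appended 2026-08-27).
NOT FORMALIZED: the Box Theorem (BB Thms 2, 7 and the first half of Thm 8 — the `λ`-constants;
Bollobás–Thomason) and its additive analogue BB Cor 11, the entropy / fractional-cover and compression versions (BB §§3–4, Thm 6), BB Thm 9
(done separately, by another route, in `RestrictedSumsetSubmultiplicativitySeveral.lean`),
Thm 12 (Cauchy–Davenport for `n` summands in `ℤ_p`: `cauchy_davenport_finSum` in
`DiasDaSilvaHamidoune.lean`).  Thm 13 (Kemperman / Wehn / DeVos, all groups) IS here: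
`min_minOrder_sub_le_card_listSum` (any additive group, iterated sumset as a list sum) and
`min_minOrder_sub_le_card_sum` (commutative form), from Mathlib's two-set
`cauchy_davenport_minOrder_add` (appended 2026-08-27).  Census-silent for the cell `mm-stpp`.

## References
* P. Balister, B. Bollobás, *Projections, entropy and sumsets*, Combinatorica 32 (2012) 125–141,
  §2 (k-covers, (UC), eq. (3) (UC-latt)), §5 Thms 8, 10 and 13 — held `paper:arxiv-0711.1151`, chunks
  p0004, p0007–p0009 read 2026-08-27 [cite: BalisterBollobas2012, §2 eq. (3); Thm 8; Thm 10; Thm 13].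
* M. Madiman, A. W. Marcus, P. Tetali, *Entropy and set cardinality inequalities for
  partition-determined functions*, Random Struct. Alg. 40 (2012) 399–424, §3.2 Thm 4 / Cor 2,
  §3.3 Cor 3, §3.4 Cor 4 — held `paper:arxiv-0901.0055`, chunks p0006, p0008–p0010 read
  2026-08-27 [cite: MadimanMarcusTetali2011, Cor 2; Cor 3; Cor 4].
* B. Bollobás, A. Thomason, *Projections of bodies and hereditary properties of hypergraphs*,
  Bull. London Math. Soc. 27 (1995) 417–424 (the Box Theorem and the Uniform Cover Inequality;
  cited from BB 2012, not held).
* K. Gyarmati, M. Matolcsi, I. Z. Ruzsa, *A superadditivity and submultiplicativity property for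
  cardinalities of sumsets*, Combinatorica 30 (2010) 163–174, Lemma 3.1 and §3 — held
  `paper:arxiv-0707.2707` [cite: GyarmatiMatolcsiRuzsa2010, Lemma 3.1; Thm 1.2].
-/

namespace Literature.Combinatorics.Additive

open Finset

namespace UniformCover

variable {X : Type*}

/-- The coordinate projection `S ↦ S_A` of `Xⁿ` onto the coordinates in `A` ("`S_A` is the projection
of `S` to the subspace spanned by `{eᵢ : i ∈ A}`"), written inside the single type `Fin n → Option X`
(entries `some (f i)` on `A`, `none` off `A`). [cite: BalisterBollobas2012, §2] -/
def proj {n : ℕ} (A : Finset (Fin n)) (f : Fin n → X) : Fin n → Option X :=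
  fun i => if i ∈ A then some (f i) else none

/-- Unfolding of `proj`. [folklore] -/
private theorem proj_apply {n : ℕ} (A : Finset (Fin n)) (f : Fin n → X) (i : Fin n) :
    proj A f i = if i ∈ A then some (f i) else none := rfl

/-- A (multi)family `𝒜` of subsets of `Fin n`, indexed by a finite type, is a `k`-COVER if every
coordinate lies in at least `k` members ("we call a multiset `𝒜` of subsets of `[n]` such that each
element `i ∈ [n]` is in at least `k` of the members of `𝒜` a `k`-cover of `[n]`").
[cite: BalisterBollobas2012, §2 (k-cover)] -/
def IsCover {ι : Type*} [Fintype ι] {n : ℕ} (k : ℕ) (𝒜 : ι → Finset (Fin n)) : Prop :=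
  ∀ i : Fin n, k ≤ #(univ.filter fun a => i ∈ 𝒜 a)

/-- A (multi)family `𝒜` of subsets of `Fin n`, indexed by a finite type, is a UNIFORM `k`-COVER if
every coordinate lies in exactly `k` members ("a `k`-uniform cover or uniform `k`-cover is one in
which every element is in precisely `k` members of `𝒜`"; Bollobás–Thomason 1995).
[cite: BalisterBollobas2012, §2 (uniform k-cover)] -/
def IsUniformCover {ι : Type*} [Fintype ι] {n : ℕ} (k : ℕ) (𝒜 : ι → Finset (Fin n)) : Prop :=
  ∀ i : Fin n, #(univ.filter fun a => i ∈ 𝒜 a) = k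

/-- A uniform `k`-cover is a `k`-cover. [cite: BalisterBollobas2012, §2] -/
theorem IsUniformCover.isCover {ι : Type*} [Fintype ι] {n k : ℕ} {𝒜 : ι → Finset (Fin n)}
    (h : IsUniformCover k 𝒜) : IsCover k 𝒜 := fun i => (h i).ge

/-- The Loomis–Whitney family `{[n] ∖ {i} : i ∈ [n]}` is a uniform `(n − 1)`-cover ("the sets
`[n] ∖ {i}` appearing in the Loomis–Whitney inequality form an `(n−1)`-uniform cover of `[n]`").
[cite: BalisterBollobas2012, §2] -/
theorem isUniformCover_compl_singleton (n : ℕ) :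
    IsUniformCover (n - 1) (fun i : Fin n => ({i}ᶜ : Finset (Fin n))) := by
  intro i
  have : (univ.filter fun a : Fin n => i ∈ ({a}ᶜ : Finset (Fin n))) = {i}ᶜ := by
    ext a
    simp [mem_compl, eq_comm]
  rw [this, card_compl, card_singleton, Fintype.card_fin]

/-- The induced family on the last `n` coordinates: `𝒜' a = {i : i.succ ∈ 𝒜 a}`. [folklore] -/
private def tailCover {ι : Type*} {n : ℕ} (𝒜 : ι → Finset (Fin (n + 1))) : ι → Finset (Fin n) :=
  fun a => univ.filter fun i => i.succ ∈ 𝒜 a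

/-- The members of the induced family containing `i` are those of `𝒜` containing `i.succ`.
[folklore] -/
private theorem filter_mem_tailCover {ι : Type*} [Fintype ι] {n : ℕ}
    (𝒜 : ι → Finset (Fin (n + 1))) (i : Fin n) :
    (univ.filter fun a => i ∈ tailCover 𝒜 a) = univ.filter fun a => i.succ ∈ 𝒜 a := by
  ext a
  simp [tailCover]

/-- The induced family of a `k`-cover is a `k`-cover. [folklore] -/
private theorem isCover_tailCover {ι : Type*} [Fintype ι] {n k : ℕ} {𝒜 : ι → Finset (Fin (n + 1))}
    (h : IsCover k 𝒜) : IsCover k (tailCover 𝒜) := fun i => by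
  rw [filter_mem_tailCover]
  exact h i.succ

/-- The induced family of a uniform `k`-cover is a uniform `k`-cover. [folklore] -/
private theorem isUniformCover_tailCover {ι : Type*} [Fintype ι] {n k : ℕ}
    {𝒜 : ι → Finset (Fin (n + 1))} (h : IsUniformCover k 𝒜) :
    IsUniformCover k (tailCover 𝒜) := fun i => by
  rw [filter_mem_tailCover]
  exact h i.succ

/-- Splitting off coordinate `0`: `proj (𝒜 a) b = cons (head) (proj (𝒜' a) (tail b))`. [folklore] -/
private theorem proj_eq_cons {ι : Type*} {n : ℕ} (𝒜 : ι → Finset (Fin (n + 1)))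
    (a : ι) (b : Fin (n + 1) → X) :
    proj (𝒜 a) b =
      Fin.cons (if (0 : Fin (n + 1)) ∈ 𝒜 a then some (b 0) else none)
        (proj (tailCover 𝒜 a) (Fin.tail b)) := by
  ext i : 1
  refine Fin.cases ?_ (fun j => ?_) i
  · simp [proj]
  · simp [proj, tailCover, Fin.tail]

/-- **Uniform Cover Inequality for finite point sets** (Bollobás–Thomason 1995; Balister–Bollobás
2012 §2 eq. (3), "(UC-latt)": "if `S` is a finite subset of `ℤⁿ` and `S_A` is the projection of `S`
to the subspace spanned by `{eᵢ : i ∈ A}`, then for every uniform `k`-cover `𝒜` of `[n]` we have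
`|S|ᵏ ≤ ∏_{A∈𝒜} |S_A|`. In fact, in this inequality we do not have to demand that the `k`-cover
`𝒜 = {A_i}` is uniform"), nonempty form, for `k`-covers and an arbitrary coordinate type `X`: for
non-empty `B ⊆ Xⁿ` and a `k`-cover `𝒜`, `|B|ᵏ ≤ ∏_a |proj_{𝒜 a}(B)|`.  Proof: induction on `n`,
slicing along coordinate `0`; the induction hypothesis on each slice with the induced cover; for
`k` chosen members containing `0` the slice projection is the fibre of the full projection over
the slice value, for every other member it embeds into the full projection; then Hölder over the
`k` chosen members (`LoomisWhitney.pow_sum_le_mul_prod_sum`) — the Loomis–Whitney argument of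
GMR 2010 Lemma 3.1 run for a general cover. [cite: BalisterBollobas2012, §2 eq. (3) (UC-latt)] -/
theorem pow_card_le_prod_card_image_proj_of_nonempty [DecidableEq X] {ι : Type*} [Fintype ι] :
    ∀ (n : ℕ) (k : ℕ) (𝒜 : ι → Finset (Fin n)), IsCover k 𝒜 →
      ∀ (B : Finset (Fin n → X)), B.Nonempty → #B ^ k ≤ ∏ a, #(B.image (proj (𝒜 a)))
  | 0, k, 𝒜, _, B, hB => by
    have hB1 : #B = 1 := by
      refine le_antisymm ?_ hB.card_pos
      calc #B ≤ #(univ : Finset (Fin 0 → X)) := card_le_card (subset_univ _)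
        _ = 1 := by simp
    rw [hB1, one_pow]
    exact Finset.one_le_prod' fun a _ => card_pos.2 (hB.image _)
  | n + 1, k, 𝒜, h𝒜, B, hB => by
    classical
    -- the `k = 0` case is trivial
    rcases Nat.eq_zero_or_pos k with rfl | hk
    · rw [pow_zero]
      exact Finset.one_le_prod' fun a _ => card_pos.2 (hB.image _)
    -- slice along coordinate `0`
    set X₀ : Finset X := B.image fun b => b 0 with hX₀
    set Bx : X → Finset (Fin (n + 1) → X) := fun x => B.filter fun b => b 0 = x with hBx
    set Tx : X → Finset (Fin n → X) := fun x => (Bx x).image Fin.tail with hTx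
    have hB_sum : #B = ∑ x ∈ X₀, #(Bx x) :=
      card_eq_sum_card_fiberwise fun b hb => mem_coe.2 (mem_image_of_mem _ (mem_coe.1 hb))
    have hmemBx : ∀ {x b}, b ∈ Bx x ↔ b ∈ B ∧ b 0 = x := fun {x b} => by rw [hBx, mem_filter]
    have hTB : ∀ x, #(Tx x) = #(Bx x) := by
      intro x
      rw [hTx, card_image_of_injOn]
      intro b hb b' hb' h
      rw [mem_coe, hmemBx] at hb hb'
      rw [← Fin.cons_self_tail b, ← Fin.cons_self_tail b', h, hb.2, hb'.2]
    -- the induced cover and `k` chosen members containing coordinate `0`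
    set 𝒜' := tailCover 𝒜 with h𝒜'
    have h𝒜'c : IsCover k 𝒜' := isCover_tailCover h𝒜
    set N : ι → ℕ := fun a => #(B.image (proj (𝒜 a))) with hN
    obtain ⟨S₁, hS₁sub, hS₁card⟩ := exists_subset_card_eq (h𝒜 0)
    have hS₁0 : ∀ a ∈ S₁, (0 : Fin (n + 1)) ∈ 𝒜 a := fun a ha => (mem_filter.1 (hS₁sub ha)).2
    -- fibres over `x` of the full projections
    set q : ι → X → ℕ := fun a x =>
      #((B.image (proj (𝒜 a))).filter fun c => c 0 = some x) with hq
    -- (i) every member: the slice projection embeds into the full projection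
    have hle : ∀ a x, #((Tx x).image (proj (𝒜' a))) ≤ N a := by
      intro a x
      set cn : (Fin n → Option X) → Fin (n + 1) → Option X :=
        @Fin.cons n (fun _ => Option X) (if (0 : Fin (n + 1)) ∈ 𝒜 a then some x else none)
        with hcn
      have hinj : Function.Injective cn := Fin.cons_right_injective (α := fun _ => Option X) _
      rw [← card_image_of_injective _ hinj]
      refine card_le_card ?_
      intro c hc
      rw [mem_image] at hc
      obtain ⟨t, ht, rfl⟩ := hc
      rw [mem_image] at ht
      obtain ⟨t', ht', rfl⟩ := ht
      rw [hTx, mem_image] at ht'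
      obtain ⟨b, hb, rfl⟩ := ht'
      rw [hmemBx] at hb
      rw [mem_image]
      refine ⟨b, hb.1, ?_⟩
      rw [proj_eq_cons, hb.2]
    -- (ii) chosen members (they contain `0`): the slice projection IS the `x`-fibre
    have heq₁ : ∀ a ∈ S₁, ∀ x, #((Tx x).image (proj (𝒜' a))) = q a x := by
      intro a ha x
      have ha0 := hS₁0 a ha
      set cx : (Fin n → Option X) → Fin (n + 1) → Option X :=
        @Fin.cons n (fun _ => Option X) (some x) with hcx
      have hinj : Function.Injective cx := Fin.cons_right_injective (α := fun _ => Option X) _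
      rw [← card_image_of_injective _ hinj, hq]
      congr 1
      ext c
      constructor
      · intro hc
        rw [mem_image] at hc
        obtain ⟨t, ht, rfl⟩ := hc
        rw [mem_image] at ht
        obtain ⟨t', ht', rfl⟩ := ht
        rw [hTx, mem_image] at ht'
        obtain ⟨b, hb, rfl⟩ := ht'
        rw [hmemBx] at hb
        rw [mem_filter, mem_image]
        refine ⟨⟨b, hb.1, ?_⟩, ?_⟩
        · rw [proj_eq_cons, if_pos ha0, hb.2]
        · rw [hcx]; exact Fin.cons_zero _ _
      · intro hc
        rw [mem_filter, mem_image] at hc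
        obtain ⟨⟨b, hb, rfl⟩, hc0⟩ := hc
        have hb0 : b 0 = x := by
          rw [proj_eq_cons, if_pos ha0] at hc0
          simpa using hc0
        rw [mem_image]
        refine ⟨proj (𝒜' a) (Fin.tail b), ?_, ?_⟩
        · rw [mem_image]
          refine ⟨Fin.tail b, ?_, rfl⟩
          rw [hTx]
          exact mem_image_of_mem _ (hmemBx.2 ⟨hb, hb0⟩)
        · rw [proj_eq_cons, if_pos ha0, hb0]
    have hq_sum : ∀ a ∈ S₁, ∑ x ∈ X₀, q a x = N a := by
      intro a ha
      have ha0 := hS₁0 a ha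
      have h1 : ∀ c ∈ B.image (proj (𝒜 a)), c 0 ∈ X₀.image some := by
        intro c hc
        rw [mem_image] at hc
        obtain ⟨b, hb, rfl⟩ := hc
        rw [proj_eq_cons, if_pos ha0, Fin.cons_zero]
        exact mem_image_of_mem _ (by rw [hX₀]; exact mem_image_of_mem _ hb)
      have h2 := card_eq_sum_card_fiberwise h1
      rw [sum_image fun x _ y _ h => Option.some_injective _ h] at h2
      simp only [hq, hN]
      exact h2.symm
    -- the induction hypothesis on each slice
    have hIH : ∀ x ∈ X₀, #(Tx x) ^ k ≤ (∏ a ∈ S₁ᶜ, N a) * ∏ a ∈ S₁, q a x := by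
      intro x hx
      have hne : (Tx x).Nonempty := by
        rw [hX₀, mem_image] at hx
        obtain ⟨b, hb, rfl⟩ := hx
        exact ⟨Fin.tail b, by rw [hTx]; exact mem_image_of_mem _ (hmemBx.2 ⟨hb, rfl⟩)⟩
      have ih := pow_card_le_prod_card_image_proj_of_nonempty n k 𝒜' h𝒜'c (Tx x) hne
      refine ih.trans ?_
      rw [← prod_mul_prod_compl S₁, mul_comm]
      refine Nat.mul_le_mul (prod_le_prod' fun a _ => hle a x) (le_of_eq ?_)
      exact prod_congr rfl fun a ha => heq₁ a ha x
    -- Hölder over the `k` chosen members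
    have hH := LoomisWhitney.pow_sum_le_mul_prod_sum X₀ S₁ hS₁card (by omega)
      (∏ a ∈ S₁ᶜ, N a) (fun x => #(Tx x)) q hIH
    rw [hB_sum]
    simp_rw [← hTB]
    refine hH.trans (le_of_eq ?_)
    rw [prod_congr rfl fun a ha => hq_sum a ha, mul_comm]
    exact prod_mul_prod_compl S₁ N

/-- The point-set Uniform Cover Inequality for `k`-covers without the non-emptiness hypothesis,
for `k ≠ 0`. [cite: BalisterBollobas2012, §2 eq. (3) (UC-latt)] -/
theorem pow_card_le_prod_card_image_proj [DecidableEq X] {ι : Type*} [Fintype ι] {n k : ℕ}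
    (hk : k ≠ 0) (𝒜 : ι → Finset (Fin n)) (h𝒜 : IsCover k 𝒜) (B : Finset (Fin n → X)) :
    #B ^ k ≤ ∏ a, #(B.image (proj (𝒜 a))) := by
  rcases B.eq_empty_or_nonempty with rfl | hB
  · rw [card_empty, zero_pow hk]
    exact Nat.zero_le _
  · exact pow_card_le_prod_card_image_proj_of_nonempty n k 𝒜 h𝒜 B hB

/-- The point-set Uniform Cover Inequality as printed, for UNIFORM `k`-covers (any `k`, non-empty
`B`). [cite: BalisterBollobas2012, §2 eq. (3) (UC-latt)] -/
theorem pow_card_le_prod_card_image_proj_of_isUniformCover [DecidableEq X] {ι : Type*}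
    [Fintype ι] {n k : ℕ} (𝒜 : ι → Finset (Fin n)) (h𝒜 : IsUniformCover k 𝒜)
    (B : Finset (Fin n → X)) (hB : B.Nonempty) : #B ^ k ≤ ∏ a, #(B.image (proj (𝒜 a))) :=
  pow_card_le_prod_card_image_proj_of_nonempty n k 𝒜 h𝒜.isCover B hB

/-- **Weighted covers.**  The point-set cover inequality for a family with multiplicities
`w a ∈ ℕ`: if every coordinate is covered at least `k` times counted with multiplicity, then
`|B|ᵏ ≤ ∏_a |B_{𝒜 a}|^{w a}` (the multiset form of (UC-latt); reduction to
`pow_card_le_prod_card_image_proj_of_nonempty` by repeating the member `𝒜 a` `w a` times).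
[cite: BalisterBollobas2012, §2 eq. (3) (UC-latt, multisets)] -/
theorem pow_card_le_prod_card_image_proj_pow_of_nonempty [DecidableEq X] {ι : Type*} [Fintype ι]
    {n k : ℕ}
    (𝒜 : ι → Finset (Fin n)) (w : ι → ℕ)
    (hw : ∀ i : Fin n, k ≤ ∑ a ∈ univ.filter (fun a => i ∈ 𝒜 a), w a)
    (B : Finset (Fin n → X)) (hB : B.Nonempty) :
    #B ^ k ≤ ∏ a, #(B.image (proj (𝒜 a))) ^ w a := by
  classical
  -- repeat the member `𝒜 a` exactly `w a` times
  set 𝒜' : (Σ a : ι, Fin (w a)) → Finset (Fin n) := fun x => 𝒜 x.1 with h𝒜'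
  have hcov : IsCover k 𝒜' := by
    intro i
    have : #(univ.filter fun x : (Σ a : ι, Fin (w a)) => i ∈ 𝒜' x) =
        ∑ a ∈ univ.filter (fun a => i ∈ 𝒜 a), w a := by
      rw [card_eq_sum_ones, sum_filter, Fintype.sum_sigma]
      rw [sum_filter]
      refine sum_congr rfl fun a _ => ?_
      simp only [h𝒜']
      split_ifs with h
      · simp
      · simp
    rw [this]
    exact hw i
  have h := pow_card_le_prod_card_image_proj_of_nonempty n k 𝒜' hcov B hB
  rw [Fintype.prod_sigma] at h
  simpa [h𝒜', prod_const, Fintype.card_fin] using h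

/-- **Madiman–Marcus–Tetali 2012, Corollary 3 (fractional coverings, set projections).**  "Let
`α` be a fractional covering using the hypergraph `𝒮` on `[k]`.  Let `X₁, …, X_k` be arbitrary
finite sets, and `Y ⊂ X_{[k]}`.  Then `|Y| ≤ ∏_{s∈𝒮} |π_s(Y)|^{α_s}`."  (A fractional covering:
`α ≥ 0` with `∑_{s ∋ i} α_s ≥ 1` for every `i`.)  Here all `X_i` equal to one type `X`.  Proof
(not the printed entropy proof): round `q α_a` up to integers `p_a = ⌈q α_a⌉`, which form a
weighted `q`-cover, apply the integer inequality
(`pow_card_le_prod_card_image_proj_pow_of_nonempty`), take `q`-th roots —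
`|Y| ≤ (∏ N_a^{α_a}) · (∏ N_a)^{1/q}` for every `q ≥ 1` — and let `q → ∞`.
[cite: MadimanMarcusTetali2011, Cor 3] -/
theorem card_le_prod_card_image_proj_rpow [DecidableEq X] {ι : Type*} [Fintype ι] {n : ℕ}
    (𝒜 : ι → Finset (Fin n)) (α : ι → ℝ) (hα : ∀ a, 0 ≤ α a)
    (hcov : ∀ i : Fin n, 1 ≤ ∑ a ∈ univ.filter (fun a => i ∈ 𝒜 a), α a)
    (B : Finset (Fin n → X)) :
    (#B : ℝ) ≤ ∏ a, (#(B.image (proj (𝒜 a))) : ℝ) ^ α a := by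
  classical
  rcases B.eq_empty_or_nonempty with rfl | hB
  · simp only [card_empty, CharP.cast_eq_zero]
    exact prod_nonneg fun a _ => Real.rpow_nonneg (le_refl _) _
  -- notation: `N a ≥ 1`, `P = ∏ N_a^{α_a} ≥ 1`, `M = ∏ N_a ≥ 1`
  set N : ι → ℝ := fun a => (#(B.image (proj (𝒜 a))) : ℝ) with hN
  have hN1 : ∀ a, 1 ≤ N a := fun a => by
    simp only [hN]
    exact_mod_cast (card_pos.2 (hB.image _))
  have hN0 : ∀ a, 0 ≤ N a := fun a => zero_le_one.trans (hN1 a)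
  set P : ℝ := ∏ a, N a ^ α a with hP
  set M : ℝ := ∏ a, N a with hM
  have hP1 : 1 ≤ P := by
    rw [hP]
    calc (1 : ℝ) = ∏ _a : ι, (1 : ℝ) := prod_const_one.symm
      _ ≤ ∏ a, N a ^ α a :=
          prod_le_prod (fun _ _ => zero_le_one) fun a _ => Real.one_le_rpow (hN1 a) (hα a)
  have hM0 : 0 ≤ M := prod_nonneg fun a _ => hN0 a
  -- the bound `|B| ≤ P · M^{1/q}` for every `q ≥ 1`
  have hq : ∀ q : ℕ, 1 ≤ q → (#B : ℝ) ≤ P * M ^ ((q : ℝ)⁻¹) := by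
    intro q hq1
    have hq0 : (0 : ℝ) < q := by exact_mod_cast hq1
    set p : ι → ℕ := fun a => ⌈α a * q⌉₊ with hp
    -- weighted `q`-cover
    have hw : ∀ i : Fin n, q ≤ ∑ a ∈ univ.filter (fun a => i ∈ 𝒜 a), p a := by
      intro i
      have h1 : (q : ℝ) ≤ ∑ a ∈ univ.filter (fun a => i ∈ 𝒜 a), (p a : ℝ) := by
        calc (q : ℝ) = 1 * q := (one_mul _).symm
          _ ≤ (∑ a ∈ univ.filter (fun a => i ∈ 𝒜 a), α a) * q :=
              mul_le_mul_of_nonneg_right (hcov i) hq0.le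
          _ = ∑ a ∈ univ.filter (fun a => i ∈ 𝒜 a), α a * q := sum_mul _ _ _
          _ ≤ ∑ a ∈ univ.filter (fun a => i ∈ 𝒜 a), (p a : ℝ) :=
              sum_le_sum fun a _ => Nat.le_ceil _
      exact_mod_cast h1
    have hint := pow_card_le_prod_card_image_proj_pow_of_nonempty 𝒜 p hw B hB
    -- cast and take `q`-th roots
    have hreal : ((#B : ℝ)) ^ (q : ℝ) ≤ ∏ a, N a ^ (p a : ℝ) := by
      have : ((#B ^ q : ℕ) : ℝ) ≤ ((∏ a, #(B.image (proj (𝒜 a))) ^ p a : ℕ) : ℝ) := by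
        exact_mod_cast hint
      simpa [Real.rpow_natCast, hN] using this
    have hroot : (#B : ℝ) ≤ (∏ a, N a ^ (p a : ℝ)) ^ ((q : ℝ)⁻¹) := by
      have h0 : (0 : ℝ) ≤ #B := Nat.cast_nonneg _
      calc (#B : ℝ) = (((#B : ℝ)) ^ (q : ℝ)) ^ ((q : ℝ)⁻¹) := by
            rw [← Real.rpow_mul h0, mul_inv_cancel₀ hq0.ne', Real.rpow_one]
        _ ≤ (∏ a, N a ^ (p a : ℝ)) ^ ((q : ℝ)⁻¹) :=
            Real.rpow_le_rpow (Real.rpow_nonneg h0 _) hreal (inv_nonneg.2 hq0.le)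
    refine hroot.trans ?_
    -- `(∏ N_a^{p_a})^{1/q} = ∏ N_a^{p_a/q} ≤ ∏ N_a^{α_a + 1/q} = P · M^{1/q}`
    rw [← Real.finsetProd_rpow _ _ (fun a _ => Real.rpow_nonneg (hN0 a) _)]
    have hexp : ∀ a, (p a : ℝ) * (q : ℝ)⁻¹ ≤ α a + (q : ℝ)⁻¹ := by
      intro a
      have h1 : (p a : ℝ) < α a * q + 1 := Nat.ceil_lt_add_one (mul_nonneg (hα a) hq0.le)
      have h2 : (p a : ℝ) * (q : ℝ)⁻¹ ≤ (α a * q + 1) * (q : ℝ)⁻¹ :=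
        mul_le_mul_of_nonneg_right h1.le (inv_nonneg.2 hq0.le)
      rw [add_mul, mul_assoc, mul_inv_cancel₀ hq0.ne', mul_one, one_mul] at h2
      exact h2
    calc ∏ a, (N a ^ (p a : ℝ)) ^ ((q : ℝ)⁻¹)
        = ∏ a, N a ^ ((p a : ℝ) * (q : ℝ)⁻¹) :=
          prod_congr rfl fun a _ => (Real.rpow_mul (hN0 a) _ _).symm
      _ ≤ ∏ a, N a ^ (α a + (q : ℝ)⁻¹) :=
          prod_le_prod (fun a _ => Real.rpow_nonneg (hN0 a) _)
            fun a _ => Real.rpow_le_rpow_of_exponent_le (hN1 a) (hexp a)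
      _ = ∏ a, (N a ^ α a * N a ^ ((q : ℝ)⁻¹)) :=
          prod_congr rfl fun a _ => Real.rpow_add (lt_of_lt_of_le one_pos (hN1 a)) _ _
      _ = P * M ^ ((q : ℝ)⁻¹) := by
          rw [prod_mul_distrib, hP, hM, Real.finsetProd_rpow _ _ (fun a _ => hN0 a)]
  -- let `q → ∞`
  by_contra hlt
  rw [not_le] at hlt
  have hP0 : 0 < P := lt_of_lt_of_le one_pos hP1
  set r : ℝ := (#B : ℝ) / P with hr
  have hr1 : 1 < r := by rw [hr, one_lt_div hP0]; exact hlt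
  obtain ⟨q, hqM⟩ := pow_unbounded_of_one_lt M hr1
  have hq1 : 1 ≤ q := by
    rcases Nat.eq_zero_or_pos q with rfl | h
    · rw [pow_zero] at hqM
      have hM1 : 1 ≤ M := by
        rw [hM]
        calc (1 : ℝ) = ∏ _a : ι, (1 : ℝ) := prod_const_one.symm
          _ ≤ ∏ a, N a := prod_le_prod (fun _ _ => zero_le_one) fun a _ => hN1 a
      exact absurd (lt_of_le_of_lt hM1 hqM) (lt_irrefl _)
    · exact h
  have hq0 : (0 : ℝ) < q := by exact_mod_cast hq1
  have hMq : M ^ ((q : ℝ)⁻¹) < r := by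
    calc M ^ ((q : ℝ)⁻¹) < (r ^ q) ^ ((q : ℝ)⁻¹) :=
          Real.rpow_lt_rpow hM0 hqM (inv_pos.2 hq0)
      _ = r := by
          rw [← Real.rpow_natCast, ← Real.rpow_mul (zero_le_one.trans hr1.le),
            mul_inv_cancel₀ hq0.ne', Real.rpow_one]
  have := hq q hq1
  have h2 : P * M ^ ((q : ℝ)⁻¹) < P * r := mul_lt_mul_of_pos_left hMq hP0
  rw [hr, mul_div_cancel₀ _ hP0.ne'] at h2
  exact absurd (lt_of_le_of_lt this h2) (lt_irrefl _)

/-- Transport of a lexicographic comparison between two vectors that agree off `A` to any other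
pair with the same `A`-parts that again agree off `A`. [folklore] -/
private theorem toLex_lt_toLex_of_agree_off {ι : Type*} [LinearOrder ι] {β : Type*}
    [PartialOrder β] (A : Finset ι) {x y x' y' : ι → β} (hxy : toLex x < toLex y)
    (hoff : ∀ i ∉ A, x i = y i) (hx' : ∀ i ∈ A, x' i = x i) (hy' : ∀ i ∈ A, y' i = y i)
    (hoff' : ∀ i ∉ A, x' i = y' i) : toLex x' < toLex y' := by
  obtain ⟨i, hlt, hi⟩ := hxy
  dsimp at hlt hi
  have hiA : i ∈ A := by
    by_contra hiA
    rw [hoff i hiA] at hi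
    exact lt_irrefl _ hi
  refine ⟨i, fun j hj => ?_, ?_⟩
  · dsimp
    by_cases hjA : j ∈ A
    · rw [hx' j hjA, hy' j hjA]
      exact hlt j hj
    · exact hoff' j hjA
  · dsimp
    rw [hx' i hiA, hy' i hiA]
    exact hi

end UniformCover

section UniformCoverSumsets

open UniformCover
open scoped Pointwise

variable {α : Type*} [AddCommMonoid α] [DecidableEq α]

/-- A pointwise sum of finsets with an empty summand is empty. [folklore] -/
private theorem sum_eq_empty_of_exists_eq_empty {n : ℕ} (S : Fin n → Finset α) {j : Fin n}
    (hj : S j = ∅) : (∑ i, S i) = ∅ := by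
  rw [← add_sum_erase univ S (mem_univ j), hj, empty_add]

/-- **The Gyarmati–Matolcsi–Ruzsa / Balister–Bollobás representation lemma.**  For finite
non-empty `S₁, …, S_n` in an additive commutative monoid there is a set `B ⊆ S₁ × ⋯ × S_n` of
representatives (the lexicographically least representations, "`S′ = φ_{[n]}(S_{[n]})`") with
`|B| = |S₁ + ⋯ + S_n|` whose every coordinate projection satisfies `|B_A| ≤ |∑_{i∈A} S_i|` ("the
projection of `S′` into `∏_{i∈A} S_i` is contained in `φ_A(S_A)` … Thus `|(S′)_A| ≤ |S_A|`").
[cite: BalisterBollobas2012, §5 (before Thm 8)] -/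
theorem exists_repr_card_image_proj_le {n : ℕ} (S : Fin n → Finset α)
    (hS : ∀ i, (S i).Nonempty) :
    ∃ B : Finset (Fin n → α), B.Nonempty ∧ #B = #(∑ i, S i) ∧
      ∀ A : Finset (Fin n), #(B.image (proj A)) ≤ #(∑ i ∈ A, S i) := by
  classical
  -- an enumeration of `⋃ S_i`
  set U : Finset α := univ.biUnion S with hU
  set rk : α → ℕ := fun u => if h : u ∈ U then (U.equivFin ⟨u, h⟩ : ℕ) else 0 with hrk
  have hrk_inj : ∀ {u v}, u ∈ U → v ∈ U → rk u = rk v → u = v := by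
    intro u v hu hv h
    simp only [hrk, dif_pos hu, dif_pos hv] at h
    have := (U.equivFin).injective (Fin.ext h)
    exact congrArg Subtype.val this
  have hSU : ∀ {i a}, a ∈ S i → a ∈ U := fun {i a} h => by
    rw [hU, mem_biUnion]
    exact ⟨i, mem_univ _, h⟩
  -- representations and the lexicographically least one
  set T := ∑ i, S i with hT
  set R : α → Finset (Fin n → α) :=
    fun s => (Fintype.piFinset S).filter fun r => ∑ i, r i = s with hR
  have hmemR : ∀ {s r}, r ∈ R s ↔ (∀ i, r i ∈ S i) ∧ ∑ i, r i = s := by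
    intro s r
    rw [hR, mem_filter, Fintype.mem_piFinset]
  have hmemT : ∀ {s}, s ∈ T ↔ ∃ g : Fin n → α, (∀ i, g i ∈ S i) ∧ ∑ i, g i = s := by
    intro s
    rw [hT, ← mem_coe, coe_sum, Set.mem_fintype_sum]
    simp only [mem_coe, exists_prop]
  have hRne : ∀ s ∈ T, (R s).Nonempty := by
    intro s hs
    obtain ⟨g, hg, hgs⟩ := hmemT.1 hs
    exact ⟨g, hmemR.2 ⟨hg, hgs⟩⟩
  set key : (Fin n → α) → Lex (Fin n → ℕ) := fun r => toLex fun i => rk (r i) with hkey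
  have hex : ∀ s ∈ T, ∃ r ∈ R s, ∀ r' ∈ R s, key r ≤ key r' :=
    fun s hs => exists_min_image (R s) key (hRne s hs)
  choose! f hfR hfmin using hex
  have hf : ∀ s ∈ T, (∀ i, f s i ∈ S i) ∧ ∑ i, f s i = s := fun s hs => hmemR.1 (hfR s hs)
  have hkey_inj : ∀ {r r' : Fin n → α}, (∀ i, r i ∈ U) → (∀ i, r' i ∈ U) →
      key r = key r' → r = r' := by
    intro r r' hr hr' h
    funext i
    have hi : rk (r i) = rk (r' i) := by
      have := congrArg (fun v : Lex (Fin n → ℕ) => (ofLex v) i) h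
      simpa [hkey] using this
    exact hrk_inj (hr i) (hr' i) hi
  -- `B = f(T)` has `|B| = |T|`
  set B := T.image f with hB
  have hBcard : #B = #T := by
    rw [hB, card_image_of_injOn fun s hs s' hs' h => ?_]
    rw [← (hf s (mem_coe.1 hs)).2, ← (hf s' (mem_coe.1 hs')).2, h]
  -- on the projection `B_A` the sum of the `A`-coordinates is injective, with values in `S_A`
  have hproj : ∀ A : Finset (Fin n),
      #(B.image (proj A)) ≤ #(∑ i ∈ A, S i) := by
    intro A
    refine card_le_card_of_injOn (fun c => ∑ i ∈ A, (c i).getD 0) (fun c hc => ?_)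
      fun c hc c' hc' hcc => ?_
    · rw [mem_coe, mem_image] at hc
      obtain ⟨x, hx, rfl⟩ := hc
      rw [hB, mem_image] at hx
      obtain ⟨s, hs, rfl⟩ := hx
      rw [mem_coe, ← mem_coe, coe_sum]
      refine (Set.mem_finsetSum A (fun i => (S i : Set α)) _).2 ⟨f s, fun {i} hi => ?_, ?_⟩
      · exact mem_coe.2 ((hf s hs).1 i)
      · exact sum_congr rfl fun i hi => by simp [proj, if_pos hi]
    · rw [mem_coe, mem_image] at hc hc'
      obtain ⟨x, hx, rfl⟩ := hc
      obtain ⟨y, hy, rfl⟩ := hc'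
      rw [hB, mem_image] at hx hy
      obtain ⟨s, hs, rfl⟩ := hx
      obtain ⟨s', hs', rfl⟩ := hy
      have hsumA : ∑ i ∈ A, f s i = ∑ i ∈ A, f s' i := by
        have e : ∀ (r : Fin n → α), ∑ i ∈ A, ((proj A r) i).getD 0 = ∑ i ∈ A, r i :=
          fun r => sum_congr rfl fun i hi => by simp [proj, if_pos hi]
        have := hcc
        dsimp only at this
        rwa [e, e] at this
      by_contra hne
      obtain ⟨hxS, hxs⟩ := hf s hs
      obtain ⟨hyS, hys⟩ := hf s' hs'
      -- the mixed representations
      set m : Fin n → α := fun i => if i ∈ A then f s' i else f s i with hm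
      set m' : Fin n → α := fun i => if i ∈ A then f s i else f s' i with hm'
      have hsplit : ∀ (r : Fin n → α), ∑ i, r i = ∑ i ∈ A, r i + ∑ i ∈ Aᶜ, r i :=
        fun r => (sum_add_sum_compl A r).symm
      have hsum_m : ∑ i, m i = s := by
        rw [hsplit, sum_congr rfl fun i (hi : i ∈ A) => if_pos hi,
          sum_congr rfl fun i (hi : i ∈ Aᶜ) => if_neg (mem_compl.1 hi), ← hsumA, ← hsplit, hxs]
      have hsum_m' : ∑ i, m' i = s' := by
        rw [hsplit, sum_congr rfl fun i (hi : i ∈ A) => if_pos hi,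
          sum_congr rfl fun i (hi : i ∈ Aᶜ) => if_neg (mem_compl.1 hi), hsumA, ← hsplit, hys]
      have hmR : m ∈ R s := by
        refine hmemR.2 ⟨fun i => ?_, hsum_m⟩
        by_cases h : i ∈ A
        · rw [hm]; dsimp only; rw [if_pos h]; exact hyS i
        · rw [hm]; dsimp only; rw [if_neg h]; exact hxS i
      have hm'R : m' ∈ R s' := by
        refine hmemR.2 ⟨fun i => ?_, hsum_m'⟩
        by_cases h : i ∈ A
        · rw [hm']; dsimp only; rw [if_pos h]; exact hxS i
        · rw [hm']; dsimp only; rw [if_neg h]; exact hyS i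
      have hmU : ∀ i, m i ∈ U := fun i => hSU ((hmemR.1 hmR).1 i)
      have hxU : ∀ i, f s i ∈ U := fun i => hSU (hxS i)
      -- `f s ≠ m` since the `A`-parts of `f s` and `f s'` differ
      have hne' : f s ≠ m := by
        intro h
        apply hne
        funext i
        by_cases hi : i ∈ A
        · have := congrFun h i
          rw [hm] at this; dsimp only at this; rw [if_pos hi] at this
          simp [proj, if_pos hi, this]
        · simp [proj, if_neg hi]
      have hkeyne : key (f s) ≠ key m := fun h => hne' (hkey_inj hxU hmU h)
      have hlt : key (f s) < key m := lt_of_le_of_ne (hfmin s hs m hmR) hkeyne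
      -- transport: `key m' < key (f s')`
      have ht : key m' < key (f s') := by
        refine toLex_lt_toLex_of_agree_off A (x := fun i => rk (f s i)) (y := fun i => rk (m i))
          (x' := fun i => rk (m' i)) (y' := fun i => rk (f s' i)) (by simpa [hkey] using hlt)
          ?_ ?_ ?_ ?_
        · intro i hi; rw [hm]; dsimp only; rw [if_neg hi]
        · intro i hi; rw [hm']; dsimp only; rw [if_pos hi]
        · intro i hi; rw [hm]; dsimp only; rw [if_pos hi]
        · intro i hi; rw [hm']; dsimp only; rw [if_neg hi]
      exact absurd (hfmin s' hs' m' hm'R) (not_le.2 ht)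
  have hTne : T.Nonempty := by
    obtain ⟨g, hg⟩ : ∃ g : Fin n → α, ∀ i, g i ∈ S i :=
      ⟨fun i => (hS i).choose, fun i => (hS i).choose_spec⟩
    exact ⟨∑ i, g i, hmemT.2 ⟨g, hg, rfl⟩⟩
  exact ⟨B, hTne.image f, hBcard, hproj⟩

/-- **Balister–Bollobás 2012, Theorem 8 / eq. (3) for sumsets, `k`-cover form.**  For finite
non-empty sets `S₁, …, S_n` in an additive commutative monoid and a `k`-cover `𝒜` of `[n]`
(every index in at least `k` members): `|S₁ + ⋯ + S_n|ᵏ ≤ ∏_{A∈𝒜} |∑_{i∈A} S_i|`.  Proof as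
printed (§5, after Gyarmati–Matolcsi–Ruzsa §3): map `s ∈ S` to its lexicographically least
representation `f(s) ∈ S₁ × ⋯ × S_n` (for a fixed enumeration of `⋃ S_i`); `B = f(S)` has
`|B| = |S|`; on the projection `B_A` the map "sum of the `A`-coordinates" is injective with values
in `S_A` (a collision yields a lexicographically smaller representation of one of the two sums —
`toLex_lt_toLex_of_agree_off`) — packaged as `exists_repr_card_image_proj_le`; and the point-set
inequality `UniformCover.pow_card_le_prod_card_image_proj_of_nonempty` applies to `B`.
[cite: BalisterBollobas2012, Thm 8] -/
theorem pow_card_sum_le_prod_card_subsum_of_isCover {ι : Type*} [Fintype ι] {n k : ℕ}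
    (𝒜 : ι → Finset (Fin n)) (h𝒜 : IsCover k 𝒜) (S : Fin n → Finset α)
    (hS : ∀ i, (S i).Nonempty) : #(∑ i, S i) ^ k ≤ ∏ a, #(∑ i ∈ 𝒜 a, S i) := by
  obtain ⟨B, hBne, hBcard, hproj⟩ := exists_repr_card_image_proj_le S hS
  have hUC := pow_card_le_prod_card_image_proj_of_nonempty n k 𝒜 h𝒜 B hBne
  rw [hBcard] at hUC
  exact hUC.trans (prod_le_prod' fun a _ => hproj (𝒜 a))


/-- **Balister–Bollobás 2012, Theorem 8 (Uniform Cover Inequality for sumsets), as printed.**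
"Let `S₁, …, S_n` be finite sets in a commutative semigroup with sum `S = S₁ + ⋯ + S_n`.  For
`A ⊆ [n]` set `S_A = ∑_{i∈A} S_i` … In particular, if `𝒜` is a uniform `k`-cover of `[n]` then
`|S|ᵏ ≤ ∏_{A∈𝒜} |S_A|`."  Here for arbitrary finite `S_i` (possibly empty) and every `k`; the
ambient structure is an additive commutative monoid (a commutative semigroup embeds in one by
adjoining a zero; the monoid is what makes the empty subsum `S_∅ = {0}` available).  The
Loomis–Whitney cover `{[n] ∖ {i}}` (`isUniformCover_compl_singleton`) gives back GMR 2010 Thm 1.2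
(`pow_card_sum_le_prod_card_sum_erase` in `SumsetSubmultiplicativity.lean`).
[cite: BalisterBollobas2012, Thm 8] -/
theorem pow_card_sum_le_prod_card_subsum {ι : Type*} [Fintype ι] {n k : ℕ}
    (𝒜 : ι → Finset (Fin n)) (h𝒜 : IsUniformCover k 𝒜) (S : Fin n → Finset α) :
    #(∑ i, S i) ^ k ≤ ∏ a, #(∑ i ∈ 𝒜 a, S i) := by
  classical
  -- `k = 0`: every member of the cover is empty and both sides are `1`
  rcases Nat.eq_zero_or_pos k with rfl | hk
  · rw [pow_zero]
    refine Finset.one_le_prod' fun a _ => card_pos.2 ?_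
    have hA : 𝒜 a = ∅ := by
      refine eq_empty_of_forall_notMem fun i hi => ?_
      have h0 := h𝒜 i
      have : a ∈ univ.filter fun a => i ∈ 𝒜 a := mem_filter.2 ⟨mem_univ _, hi⟩
      rw [card_eq_zero.1 h0] at this
      exact notMem_empty _ this
    rw [hA, sum_empty]
    exact zero_nonempty
  -- an empty summand: the left-hand side vanishes
  by_cases hS : ∀ i, (S i).Nonempty
  · exact pow_card_sum_le_prod_card_subsum_of_isCover 𝒜 h𝒜.isCover S hS
  · push Not at hS
    obtain ⟨j, hj⟩ := hS
    rw [sum_eq_empty_of_exists_eq_empty S hj, card_empty, zero_pow hk.ne']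
    exact Nat.zero_le _

/-- The Gyarmati–Matolcsi–Ruzsa submultiplicativity inequality (GMR 2010 Thm 1.2) as the
Loomis–Whitney instance of Theorem 8: `|∑_i S_i|^(n−1) ≤ ∏_i |∑_{j ≠ i} S_j|` for finite sets
`S_i`, `i < n` (empty sets allowed when `n ≥ 2`). [cite: BalisterBollobas2012, Thm 8] -/
theorem pow_card_sum_le_prod_card_sum_compl_singleton {n : ℕ} (S : Fin n → Finset α) :
    #(∑ i, S i) ^ (n - 1) ≤ ∏ i : Fin n, #(∑ j ∈ ({i}ᶜ : Finset (Fin n)), S j) :=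
  pow_card_sum_le_prod_card_subsum _ (isUniformCover_compl_singleton n) S

/-- The `k`-cover form of Theorem 8 for arbitrary finite `S_i` (possibly empty), `k ≠ 0`.
[cite: BalisterBollobas2012, Thm 8] -/
theorem pow_card_sum_le_prod_card_subsum_of_isCover_of_ne_zero {ι : Type*} [Fintype ι]
    {n k : ℕ} (hk : k ≠ 0) (𝒜 : ι → Finset (Fin n)) (h𝒜 : IsCover k 𝒜)
    (S : Fin n → Finset α) : #(∑ i, S i) ^ k ≤ ∏ a, #(∑ i ∈ 𝒜 a, S i) := by
  classical
  by_cases hS : ∀ i, (S i).Nonempty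
  · exact pow_card_sum_le_prod_card_subsum_of_isCover 𝒜 h𝒜 S hS
  · push Not at hS
    obtain ⟨j, hj⟩ := hS
    rw [sum_eq_empty_of_exists_eq_empty S hj, card_empty, zero_pow hk]
    exact Nat.zero_le _

/-- **Madiman–Marcus–Tetali 2012, Corollary 4 for the full sumset ("Illustrative Set Result").**
"if `𝒮` is a `r`-regular hypergraph [on `[k]`], then for any `D ⊆ B⁺_{[k]}`,
`|A + D|^{|𝒮|} ≤ |D|^{|𝒮|−r} ∏_{s∈𝒮} |A + B⁺_s|`", `B⁺_s = ∑_{i∈s} B_i`, in the case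
`D = B⁺_{[k]} = B₁ + ⋯ + B_k` — the case in which the printed proof (Thm 5: lexicographic
representatives of `A + D` project onto `D`) is valid; for proper `D ⊊ B⁺_{[k]}` that step fails
(see `RestrictedSumsetSubmultiplicativitySeveral.lean`; the singleton family is proved there by
another route as `card_add_pow_le_card_pow_mul_prod_card_add`, the leave-one-out family is
Gyarmati–Matolcsi–Ruzsa's open Problem 1.5).  Proof: Balister–Bollobás Thm 8
(`pow_card_sum_le_prod_card_subsum`) for the sets `B₁, …, B_k, A` and the uniform `|𝒮|`-cover of
`[k+1]` by the sets `s ∪ {k+1}` (`s ∈ 𝒮`) and `|𝒮| − r` copies of `[k]`.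
[cite: MadimanMarcusTetali2011, Cor 4 (D = B⁺_[k])] -/
theorem card_add_sum_pow_le_of_isUniformCover {ι : Type*} [Fintype ι] {k r : ℕ}
    (𝒮 : ι → Finset (Fin k)) (h𝒮 : IsUniformCover r 𝒮) (B : Fin k → Finset α) (A : Finset α) :
    #(A + ∑ i, B i) ^ Fintype.card ι ≤
      #(∑ i, B i) ^ (Fintype.card ι - r) * ∏ s, #(A + ∑ i ∈ 𝒮 s, B i) := by
  classical
  set m : ℕ := Fintype.card ι - r with hm
  -- the sets `B₁, …, B_k, A`
  set S' : Fin (k + 1) → Finset α := Fin.snoc B A with hS'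
  have hS'c : ∀ i : Fin k, S' i.castSucc = B i := fun i => by simp [hS']
  have hS'l : S' (Fin.last k) = A := by simp [hS']
  -- the cover: `s ∪ {k+1}` for `s ∈ 𝒮`, and `m` copies of `[k]`
  set 𝒜 : ι ⊕ Fin m → Finset (Fin (k + 1)) :=
    Sum.elim (fun s => insert (Fin.last k) ((𝒮 s).map Fin.castSuccEmb))
      (fun _ => (univ : Finset (Fin k)).map Fin.castSuccEmb) with h𝒜
  have h𝒜l : ∀ s, 𝒜 (Sum.inl s) = insert (Fin.last k) ((𝒮 s).map Fin.castSuccEmb) :=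
    fun s => by rw [h𝒜, Sum.elim_inl]
  have h𝒜r : ∀ b, 𝒜 (Sum.inr b) = (univ : Finset (Fin k)).map Fin.castSuccEmb :=
    fun b => by rw [h𝒜, Sum.elim_inr]
  have hmem_l : ∀ s (i : Fin k), i.castSucc ∈ 𝒜 (Sum.inl s) ↔ i ∈ 𝒮 s := by
    intro s i
    rw [h𝒜l s, mem_insert]
    constructor
    · rintro (h | h)
      · exact absurd h (Fin.castSucc_ne_last i)
      · rw [mem_map] at h
        obtain ⟨j, hj, hji⟩ := h
        have : j = i := Fin.castSucc_injective _ (by simpa using hji)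
        exact this ▸ hj
    · intro h
      exact Or.inr (mem_map.2 ⟨i, h, rfl⟩)
  have hmem_r : ∀ b (i : Fin k), i.castSucc ∈ 𝒜 (Sum.inr b) := by
    intro b i
    rw [h𝒜r b]
    exact mem_map.2 ⟨i, mem_univ _, rfl⟩
  have hlast_l : ∀ s, Fin.last k ∈ 𝒜 (Sum.inl s) := fun s => by
    rw [h𝒜l s]; exact mem_insert_self _ _
  have hlast_r : ∀ b, Fin.last k ∉ 𝒜 (Sum.inr b) := by
    intro b h
    rw [h𝒜r b, mem_map] at h
    obtain ⟨i, -, hi⟩ := h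
    rw [Fin.coe_castSuccEmb] at hi
    exact Fin.castSucc_ne_last i hi
  -- `r ≤ |ι|` as soon as there is a coordinate
  have hr : ∀ i : Fin k, r + m = Fintype.card ι := by
    intro i
    have : r ≤ Fintype.card ι := by
      rw [← h𝒮 i]
      exact (card_le_univ _)
    omega
  have hcov : IsUniformCover (Fintype.card ι) 𝒜 := by
    intro j
    rw [card_eq_sum_ones, sum_filter, Fintype.sum_sum_type]
    induction j using Fin.lastCases with
    | last => simp [hlast_l, hlast_r]
    | cast i =>
      have e1 : ∑ s : ι, (if i.castSucc ∈ 𝒜 (Sum.inl s) then 1 else 0) = r := by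
        rw [sum_boole, filter_congr fun s _ => hmem_l s i]
        exact h𝒮 i
      have e2 : ∑ b : Fin m, (if i.castSucc ∈ 𝒜 (Sum.inr b) then 1 else 0) = m := by
        rw [sum_boole, filter_true_of_mem fun b _ => hmem_r b i, card_univ, Fintype.card_fin]
        exact Nat.cast_id m
      rw [e1, e2]
      exact hr i
  -- Theorem 8
  have h8 := pow_card_sum_le_prod_card_subsum 𝒜 hcov S'
  -- identify the sums
  have hsum : ∑ i, S' i = A + ∑ i, B i := by
    rw [Fin.sum_univ_castSucc, hS'l, add_comm]
    simp only [hS'c]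
  have hsub_l : ∀ s, ∑ i ∈ 𝒜 (Sum.inl s), S' i = A + ∑ i ∈ 𝒮 s, B i := by
    intro s
    rw [h𝒜l s, sum_insert, sum_map, hS'l]
    · simp only [Fin.coe_castSuccEmb, hS'c]
    · intro h
      rw [mem_map] at h
      obtain ⟨i, -, hi⟩ := h
      exact Fin.castSucc_ne_last i hi
  have hsub_r : ∀ b, ∑ i ∈ 𝒜 (Sum.inr b), S' i = ∑ i, B i := by
    intro b
    rw [h𝒜r b, sum_map]
    simp only [Fin.coe_castSuccEmb, hS'c]
  rw [hsum, Fintype.prod_sum_type] at h8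
  simp only [hsub_l, hsub_r, prod_const, card_univ, Fintype.card_fin] at h8
  rw [mul_comm]
  exact h8

end UniformCoverSumsets

section FractionalCoverSumsets

open UniformCover
open scoped Pointwise

variable {α : Type*} [AddCommMonoid α] [DecidableEq α]

/-- **Madiman–Marcus–Tetali 2012, Corollary 2 for sumsets (fractional coverings).**  "Suppose
`f` is partition-determined with respect to `𝒮`, and `α` is a fractional covering of `[k]` using
`𝒮`.  Then `|f(X_{[k]})| ≤ ∏_{s∈𝒮} |f(X_s)|^{α_s}`", for the basic example of a
partition-determined `f`, the sum in an abelian (semi)group (their §3.4): for finite sets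
`S₁, …, S_n` and `β ≥ 0` with `∑_{a ∋ i} β_a ≥ 1` for every `i`,
`|S₁ + ⋯ + S_n| ≤ ∏_a |∑_{i∈𝒜 a} S_i|^{β_a}` (Balister–Bollobás 2012 Thm 8 is the case of a
uniform cover with `β ≡ 1/k`, raised to the `k`-th power).  Proof (not the printed entropy
proof): the representation lemma `exists_repr_card_image_proj_le` and the fractional point-set
inequality `UniformCover.card_le_prod_card_image_proj_rpow`.
[cite: MadimanMarcusTetali2011, Cor 2 (f = sum)] -/
theorem card_sum_le_prod_card_subsum_rpow {ι : Type*} [Fintype ι] {n : ℕ}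
    (𝒜 : ι → Finset (Fin n)) (β : ι → ℝ) (hβ : ∀ a, 0 ≤ β a)
    (hcov : ∀ i : Fin n, 1 ≤ ∑ a ∈ univ.filter (fun a => i ∈ 𝒜 a), β a)
    (S : Fin n → Finset α) :
    (#(∑ i, S i) : ℝ) ≤ ∏ a, (#(∑ i ∈ 𝒜 a, S i) : ℝ) ^ β a := by
  classical
  by_cases hS : ∀ i, (S i).Nonempty
  · obtain ⟨B, -, hBcard, hproj⟩ := exists_repr_card_image_proj_le S hS
    rw [← hBcard]
    refine (card_le_prod_card_image_proj_rpow 𝒜 β hβ hcov B).trans ?_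
    exact prod_le_prod (fun a _ => Real.rpow_nonneg (Nat.cast_nonneg _) _) fun a _ =>
      Real.rpow_le_rpow (Nat.cast_nonneg _) (by exact_mod_cast hproj (𝒜 a)) (hβ a)
  · push Not at hS
    obtain ⟨j, hj⟩ := hS
    have : (∑ i, S i) = ∅ := by
      rw [← add_sum_erase univ S (mem_univ j), hj, empty_add]
    rw [this, card_empty, Nat.cast_zero]
    exact prod_nonneg fun a _ => Real.rpow_nonneg (Nat.cast_nonneg _) _

end FractionalCoverSumsets

/-! ## Theorem 10: uniform-cover superadditivity in torsion-free abelian groups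

Appended 2026-08-27 (same seat, same session): Balister–Bollobás 2012 §5 Theorem 10, the additive
companion of Theorem 8 generalising Gyarmati–Matolcsi–Ruzsa 2010 Theorem 1.1 (the Loomis–Whitney
cover; `SumsetSuperadditivity.lean`) to every uniform `k`-cover.  Source: `paper:arxiv-0711.1151`
chunks p0008 (statement and proof) – p0009, read at the page 2026-08-27. -/

section UniformCoverSuperadditivity

open UniformCover
open scoped Pointwise

/-- Counting in consecutive half-open intervals telescopes. [folklore] -/
private theorem sum_card_filter_Ioc {β : Type*} [LinearOrder β] (T : Finset β) (u : ℕ → β)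
    (hu : ∀ j, u j ≤ u (j + 1)) :
    ∀ n : ℕ, ∑ j ∈ range n, #(T.filter fun x => u j < x ∧ x ≤ u (j + 1)) =
      #(T.filter fun x => u 0 < x ∧ x ≤ u n)
  | 0 => by
    rw [sum_range_zero, eq_comm, card_eq_zero, filter_eq_empty_iff]
    intro x _ h
    exact absurd (lt_of_lt_of_le h.1 h.2) (lt_irrefl _)
  | n + 1 => by
    have hmono : Monotone u := monotone_nat_of_le_succ hu
    rw [sum_range_succ, sum_card_filter_Ioc T u hu n, ← card_union_of_disjoint]
    · congr 1
      ext x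
      simp only [mem_union, mem_filter]
      constructor
      · rintro (⟨hx, h0, hn⟩ | ⟨hx, hn, hn1⟩)
        · exact ⟨hx, h0, hn.trans (hu n)⟩
        · exact ⟨hx, lt_of_le_of_lt (hmono (Nat.zero_le n)) hn, hn1⟩
      · rintro ⟨hx, h0, hn1⟩
        by_cases h : x ≤ u n
        · exact Or.inl ⟨hx, h0, h⟩
        · exact Or.inr ⟨hx, lt_of_not_ge h, hn1⟩
    · rw [disjoint_left]
      intro x h1 h2
      rw [mem_filter] at h1 h2
      exact absurd (lt_of_le_of_lt h1.2.2 h2.2.1) (lt_irrefl _)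

/-- A sum of chosen elements lies in the sum of the finsets. [folklore] -/
private theorem sum_mem_sum_of_mem {H : Type*} [AddCommMonoid H] [DecidableEq H] {ι : Type*}
    {A : ι → Finset H} {m : ι → H} (T : Finset ι)
    (hm : ∀ j ∈ T, m j ∈ A j) : ∑ j ∈ T, m j ∈ ∑ j ∈ T, A j := by
  classical
  induction T using Finset.induction_on with
  | empty => simp
  | insert a T haT ih =>
    rw [sum_insert haT, sum_insert haT]
    exact Finset.add_mem_add (hm a (mem_insert_self _ _))
      (ih fun j hj => hm j (mem_insert_of_mem hj))

/-- Elements of a sum of finsets are bracketed by the sums of lower and upper bounds. [folklore] -/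
private theorem sum_le_of_mem_sum {H : Type*} [AddCommMonoid H] [PartialOrder H]
    [IsOrderedAddMonoid H] [DecidableEq H] {ι : Type*} {A : ι → Finset H} {m M : ι → H}
    (T : Finset ι)
    (hm : ∀ j ∈ T, ∀ x ∈ A j, m j ≤ x) (hM : ∀ j ∈ T, ∀ x ∈ A j, x ≤ M j) :
    ∀ x ∈ ∑ j ∈ T, A j, ∑ j ∈ T, m j ≤ x ∧ x ≤ ∑ j ∈ T, M j := by
  classical
  induction T using Finset.induction_on with
  | empty =>
    intro x hx
    rw [sum_empty] at hx
    rw [Finset.mem_zero] at hx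
    subst hx
    simp
  | insert a T haT ih =>
    intro x hx
    rw [sum_insert haT, Finset.mem_add] at hx
    obtain ⟨y, hy, z, hz, rfl⟩ := hx
    have ihz := ih (fun j hj => hm j (mem_insert_of_mem hj)) (fun j hj => hM j (mem_insert_of_mem hj))
      z hz
    rw [sum_insert haT, sum_insert haT]
    exact ⟨add_le_add (hm a (mem_insert_self _ _) y hy) ihz.1,
      add_le_add (hM a (mem_insert_self _ _) y hy) ihz.2⟩

variable {G : Type*} [AddCommGroup G] [LinearOrder G] [IsOrderedAddMonoid G]

/-- **Balister–Bollobás 2012, Theorem 10, core marking inequality in a linearly ordered abelian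
group.**  If `E_i` contains the least and the greatest element of `S_i` for every `i`, then for
every uniform `k`-cover `𝒜` of `[n]`, with `S_A = ∑_{i∈A} S_i` and
`S′ = ⋃_{A∈𝒜} (S_A + ∑_{i∉A} E_i)`: `∑_{A∈𝒜} |S_A| ≤ k (|S′| − 1) + |𝒜|`, i.e. the printed
"`k(|S′| − 1) ≥ ∑_{A∈𝒜} (|S_A| − 1)`" (every `|S_A| ≥ 1`).  Proof as printed (§5), with the
thresholds `t_l = ∑_{i<l} max S_i + ∑_{i≥l} min S_i` in place of the normalisation `min S_i = 0`
and without the (immaterial) packing of the `k × n` grid: for `l ∈ A` the elements of `S_A` in the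
`l`-th `A`-relative threshold interval, translated by `∑_{i∉A} θ_i(l) ∈ ∑_{i∉A} E_i`, are distinct
elements of `S′ ∩ (t_l, t_{l+1}]`; each column `l` is used by exactly `k` members; the intervals
`(t_l, t_{l+1}]` partition `(min S, max S]` and `min S = t_0 ∈ S′`.
[cite: BalisterBollobas2012, Thm 10 (proof)] -/
theorem sum_card_subsum_le_of_isUniformCover_core {ι : Type*} [Fintype ι] {n k : ℕ}
    (𝒜 : ι → Finset (Fin n)) (h𝒜 : IsUniformCover k 𝒜) (S E : Fin n → Finset G)
    (hS : ∀ i, (S i).Nonempty) (hmin : ∀ i, (S i).min' (hS i) ∈ E i)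
    (hmax : ∀ i, (S i).max' (hS i) ∈ E i) :
    ∑ a, #(∑ i ∈ 𝒜 a, S i) ≤
      k * (#(univ.biUnion fun a => (∑ i ∈ 𝒜 a, S i) + ∑ i ∈ (𝒜 a)ᶜ, E i) - 1) + Fintype.card ι := by
  classical
  -- minima, maxima
  set m : Fin n → G := fun i => (S i).min' (hS i) with hm
  set M : Fin n → G := fun i => (S i).max' (hS i) with hM
  have hmle : ∀ i, ∀ x ∈ S i, m i ≤ x := fun i x hx => min'_le _ x hx
  have hMge : ∀ i, ∀ x ∈ S i, x ≤ M i := fun i x hx => le_max' _ x hx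
  have hmM : ∀ i, m i ≤ M i := fun i => hmle i _ (max'_mem _ _)
  have hmS : ∀ i, m i ∈ S i := fun i => min'_mem _ _
  -- thresholds: `θ i l = M i` if `i < l`, else `m i`
  set θ : Fin n → ℕ → G := fun i l => if (i : ℕ) < l then M i else m i with hθ
  have hθ_succ : ∀ i l, θ i l ≤ θ i (l + 1) := by
    intro i l
    simp only [hθ]
    by_cases h1 : (i : ℕ) < l
    · rw [if_pos h1, if_pos (Nat.lt_succ_of_lt h1)]
    · rw [if_neg h1]
      split_ifs
      · exact hmM i
      · exact le_rfl
  have hθ_mem : ∀ i l, θ i l ∈ E i := by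
    intro i l
    simp only [hθ]
    split_ifs
    · exact hmax i
    · exact hmin i
  have hθ_ne : ∀ (i : Fin n) (l : ℕ), (i : ℕ) ≠ l → θ i (l + 1) = θ i l := by
    intro i l h
    simp only [hθ]
    have : ((i : ℕ) < l + 1) ↔ ((i : ℕ) < l) := by omega
    simp only [this]
  set S' : Finset G := univ.biUnion fun a => (∑ i ∈ 𝒜 a, S i) + ∑ i ∈ (𝒜 a)ᶜ, E i with hS'
  set t : ℕ → G := fun l => ∑ i, θ i l with ht
  set tA : ι → ℕ → G := fun a l => ∑ i ∈ 𝒜 a, θ i l with htA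
  set dA : ι → ℕ → G := fun a l => ∑ i ∈ (𝒜 a)ᶜ, θ i l with hdA
  have ht_split : ∀ a l, t l = tA a l + dA a l := fun a l => (sum_add_sum_compl (𝒜 a) _).symm
  have ht_succ : ∀ l, t l ≤ t (l + 1) := fun l => sum_le_sum fun i _ => hθ_succ i l
  have htA_succ : ∀ a l, tA a l ≤ tA a (l + 1) := fun a l => sum_le_sum fun i _ => hθ_succ i l
  -- `S_A ⊆ [tA a 0, tA a n]`, `tA a 0 ∈ S_A`
  have htA0 : ∀ a, tA a 0 = ∑ i ∈ 𝒜 a, m i := fun a =>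
    sum_congr rfl fun i _ => by simp [hθ]
  have htAn : ∀ a, tA a n = ∑ i ∈ 𝒜 a, M i := fun a =>
    sum_congr rfl fun i _ => by simp [hθ, i.isLt]
  have hSA_bounds : ∀ a, ∀ x ∈ ∑ i ∈ 𝒜 a, S i, tA a 0 ≤ x ∧ x ≤ tA a n := by
    intro a x hx
    rw [htA0, htAn]
    exact sum_le_of_mem_sum (𝒜 a) (fun i _ => hmle i) (fun i _ => hMge i) x hx
  have htA0_mem : ∀ a, tA a 0 ∈ ∑ i ∈ 𝒜 a, S i := fun a => by
    rw [htA0]; exact sum_mem_sum_of_mem _ fun i _ => hmS i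
  -- (1) `#S_A − 1 = Σ_{l<n} #(S_A ∩ (tA l, tA (l+1)])`
  have hcount : ∀ a, #(∑ i ∈ 𝒜 a, S i) - 1 =
      ∑ l ∈ range n, #((∑ i ∈ 𝒜 a, S i).filter fun x => tA a l < x ∧ x ≤ tA a (l + 1)) := by
    intro a
    rw [sum_card_filter_Ioc _ (tA a) (htA_succ a) n]
    have : ((∑ i ∈ 𝒜 a, S i).filter fun x => tA a 0 < x ∧ x ≤ tA a n) =
        (∑ i ∈ 𝒜 a, S i).erase (tA a 0) := by
      ext x
      simp only [mem_filter, mem_erase]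
      constructor
      · rintro ⟨hx, h0, -⟩
        exact ⟨ne_of_gt h0, hx⟩
      · rintro ⟨hne, hx⟩
        exact ⟨hx, lt_of_le_of_ne (hSA_bounds a x hx).1 (Ne.symm hne), (hSA_bounds a x hx).2⟩
    rw [this, card_erase_of_mem (htA0_mem a)]
  -- (2) for `l < n`: the `l`-th slice of `S_A` embeds into the `l`-th slice of `S'` when `l ∈ A`,
  -- and is empty otherwise
  have hslice : ∀ a (l : ℕ) (hl : l < n),
      #((∑ i ∈ 𝒜 a, S i).filter fun x => tA a l < x ∧ x ≤ tA a (l + 1)) ≤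
        if (⟨l, hl⟩ : Fin n) ∈ 𝒜 a then #(S'.filter fun x => t l < x ∧ x ≤ t (l + 1))
        else 0 := by
    intro a l hl
    split_ifs with hlA
    · -- translate by `dA a l`
      have hd : dA a (l + 1) = dA a l := by
        refine sum_congr rfl fun i hi => hθ_ne i l ?_
        intro h
        rw [mem_compl] at hi
        apply hi
        have : i = ⟨l, hl⟩ := Fin.ext h
        rw [this]; exact hlA
      have hdmem : dA a l ∈ ∑ i ∈ (𝒜 a)ᶜ, E i := sum_mem_sum_of_mem _ fun i _ => hθ_mem i l
      rw [← card_image_of_injective _ (add_left_injective (dA a l))]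
      refine card_le_card fun y hy => ?_
      rw [mem_image] at hy
      obtain ⟨x, hx, rfl⟩ := hy
      rw [mem_filter] at hx ⊢
      refine ⟨?_, ?_, ?_⟩
      · rw [hS', mem_biUnion]
        exact ⟨a, mem_univ _, Finset.add_mem_add hx.1 hdmem⟩
      · rw [ht_split a l]
        exact add_lt_add_of_lt_of_le hx.2.1 le_rfl
      · rw [ht_split a (l + 1), hd]
        exact add_le_add hx.2.2 le_rfl
    · rw [Nat.le_zero, card_eq_zero, filter_eq_empty_iff]
      intro x _ h
      have : tA a (l + 1) = tA a l := by
        refine sum_congr rfl fun i hi => hθ_ne i l ?_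
        intro h'
        apply hlA
        have : i = ⟨l, hl⟩ := Fin.ext h'
        rw [← this]; exact hi
      rw [this] at h
      exact absurd (lt_of_lt_of_le h.1 h.2) (lt_irrefl _)
  -- (3) sum over `a` for fixed `l`: uniform multiplicity `k`
  have hcol : ∀ l < n,
      ∑ a, #((∑ i ∈ 𝒜 a, S i).filter fun x => tA a l < x ∧ x ≤ tA a (l + 1)) ≤
        k * #(S'.filter fun x => t l < x ∧ x ≤ t (l + 1)) := by
    intro l hl
    refine (sum_le_sum fun a _ => hslice a l hl).trans ?_
    rw [← sum_filter, sum_const, smul_eq_mul, h𝒜 ⟨l, hl⟩]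
  -- (4) sum over `l`
  have hrow : ∑ l ∈ range n, #(S'.filter fun x => t l < x ∧ x ≤ t (l + 1)) ≤ #S' - 1 := by
    rw [sum_card_filter_Ioc _ t ht_succ n]
    rcases isEmpty_or_nonempty ι with hι | hι
    · have : S' = ∅ := by
        rw [hS', univ_eq_empty, biUnion_empty]
      simp [this]
    · obtain ⟨a⟩ := hι
      have ht0 : t 0 ∈ S' := by
        rw [hS', mem_biUnion]
        refine ⟨a, mem_univ _, ?_⟩
        rw [ht_split a 0]
        exact Finset.add_mem_add (htA0_mem a) (sum_mem_sum_of_mem _ fun i _ => hθ_mem i 0)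
      calc #(S'.filter fun x => t 0 < x ∧ x ≤ t n) ≤ #(S'.erase (t 0)) :=
            card_le_card fun x hx => by
              rw [mem_filter] at hx
              exact mem_erase.2 ⟨ne_of_gt hx.2.1, hx.1⟩
        _ = #S' - 1 := card_erase_of_mem ht0
  -- assemble
  have hmain : ∑ a, (#(∑ i ∈ 𝒜 a, S i) - 1) ≤ k * (#S' - 1) := by
    calc ∑ a, (#(∑ i ∈ 𝒜 a, S i) - 1)
        = ∑ a, ∑ l ∈ range n,
            #((∑ i ∈ 𝒜 a, S i).filter fun x => tA a l < x ∧ x ≤ tA a (l + 1)) :=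
          sum_congr rfl fun a _ => hcount a
      _ = ∑ l ∈ range n, ∑ a,
            #((∑ i ∈ 𝒜 a, S i).filter fun x => tA a l < x ∧ x ≤ tA a (l + 1)) := sum_comm
      _ ≤ ∑ l ∈ range n, k * #(S'.filter fun x => t l < x ∧ x ≤ t (l + 1)) :=
          sum_le_sum fun l hl => hcol l (mem_range.1 hl)
      _ = k * ∑ l ∈ range n, #(S'.filter fun x => t l < x ∧ x ≤ t (l + 1)) := by
          rw [mul_sum]
      _ ≤ k * (#S' - 1) := Nat.mul_le_mul_left _ hrow
  have hge1 : ∀ a, 1 ≤ #(∑ i ∈ 𝒜 a, S i) := fun a => card_pos.2 ⟨_, htA0_mem a⟩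
  have : ∑ a, #(∑ i ∈ 𝒜 a, S i) = ∑ a, (#(∑ i ∈ 𝒜 a, S i) - 1 + 1) :=
    sum_congr rfl fun a _ => (Nat.sub_add_cancel (hge1 a)).symm
  rw [this, sum_add_distrib, sum_const, smul_eq_mul, mul_one, Finset.card_univ]
  exact Nat.add_le_add_right hmain _

/-- Pointwise sums of finsets are monotone in each summand family. [folklore] -/
private theorem finsetSum_subset_finsetSum {H : Type*} [AddCommMonoid H] [DecidableEq H]
    {ι : Type*} {A B : ι → Finset H} (T : Finset ι) (h : ∀ j ∈ T, A j ⊆ B j) :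
    ∑ j ∈ T, A j ⊆ ∑ j ∈ T, B j := by
  classical
  induction T using Finset.induction_on with
  | empty => simp
  | insert a T haT ih =>
    rw [sum_insert haT, sum_insert haT]
    exact Finset.add_subset_add (h a (mem_insert_self _ _))
      (ih fun j hj => h j (mem_insert_of_mem hj))

/-- `S′ ⊆ S`: if `E_i ⊆ S_i` then `⋃_{A∈𝒜} (S_A + ∑_{i∉A} E_i) ⊆ S₁ + ⋯ + S_n`.
[cite: BalisterBollobas2012, Thm 10 (proof: "it is clear that |S| ≥ |S′|")] -/
theorem biUnion_subsum_add_subset_sum {H : Type*} [AddCommMonoid H] [DecidableEq H]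
    {ι : Type*} [Fintype ι] {n : ℕ} (𝒜 : ι → Finset (Fin n)) (S E : Fin n → Finset H)
    (hE : ∀ i, E i ⊆ S i) :
    (univ.biUnion fun a => (∑ i ∈ 𝒜 a, S i) + ∑ i ∈ (𝒜 a)ᶜ, E i) ⊆ ∑ i, S i := by
  classical
  refine biUnion_subset.2 fun a _ => ?_
  rw [← sum_add_sum_compl (𝒜 a) S]
  exact Finset.add_subset_add_left (finsetSum_subset_finsetSum _ fun i _ => hE i)

/-- **Balister–Bollobás 2012, Theorem 10, in a linearly ordered abelian group** (printed for
torsion-free abelian groups, which "can be given an ordering compatible with addition"): for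
finite non-empty `S₁, …, S_n`, with `S′_i = {min S_i, max S_i}`, every uniform `k`-cover `𝒜` of
`[n]` satisfies "`k(|S| − 1) ≥ k(|S′| − 1) ≥ ∑_{A∈𝒜} (|S_A| − 1)`, where `S′` is the set of sums
`s₁ + ⋯ + s_n ∈ S` such that `{i : s_i ∉ S′_i} ⊆ A` for some `A ∈ 𝒜`", i.e.
`S′ = ⋃_{A∈𝒜} (S_A + ∑_{i∉A} S′_i) ⊆ S` and `∑_{A∈𝒜} |S_A| ≤ k(|S′| − 1) + |𝒜|`.  The family `E`
returned IS `i ↦ S′_i` (first conjunct).  The Loomis–Whitney cover gives back GMR 2010 Thm 1.1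
(`gmr_superadditivity_biUnion` in `SumsetSuperadditivity.lean`).
[cite: BalisterBollobas2012, Thm 10] -/
theorem sum_card_subsum_le_of_isUniformCover {ι : Type*} [Fintype ι] {n k : ℕ}
    (𝒜 : ι → Finset (Fin n)) (h𝒜 : IsUniformCover k 𝒜) (S : Fin n → Finset G)
    (hS : ∀ i, (S i).Nonempty) :
    ∃ E : Fin n → Finset G, (∀ i, E i = {(S i).min' (hS i), (S i).max' (hS i)}) ∧
      (univ.biUnion fun a => (∑ i ∈ 𝒜 a, S i) + ∑ i ∈ (𝒜 a)ᶜ, E i) ⊆ ∑ i, S i ∧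
      ∑ a, #(∑ i ∈ 𝒜 a, S i) ≤
        k * (#(univ.biUnion fun a => (∑ i ∈ 𝒜 a, S i) + ∑ i ∈ (𝒜 a)ᶜ, E i) - 1) +
          Fintype.card ι := by
  refine ⟨fun i => {(S i).min' (hS i), (S i).max' (hS i)}, fun i => rfl, ?_, ?_⟩
  · refine biUnion_subsum_add_subset_sum 𝒜 S _ fun i x hx => ?_
    rw [mem_insert, mem_singleton] at hx
    rcases hx with rfl | rfl
    · exact min'_mem _ _
    · exact max'_mem _ _
  · exact sum_card_subsum_le_of_isUniformCover_core 𝒜 h𝒜 S _ hS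
      (fun i => mem_insert_self _ _) (fun i => mem_insert_of_mem (mem_singleton_self _))

/-- **Balister–Bollobás 2012, Theorem 10, first printed inequality** (linearly ordered abelian
group): `∑_{A∈𝒜} |S_A| ≤ k(|S₁ + ⋯ + S_n| − 1) + |𝒜|`, i.e. "`k(|S| − 1) ≥ ∑_{A∈𝒜}(|S_A| − 1)`",
for every uniform `k`-cover `𝒜` and non-empty `S_i`. [cite: BalisterBollobas2012, Thm 10] -/
theorem sum_card_subsum_le_mul_card_sum {ι : Type*} [Fintype ι] {n k : ℕ}
    (𝒜 : ι → Finset (Fin n)) (h𝒜 : IsUniformCover k 𝒜) (S : Fin n → Finset G)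
    (hS : ∀ i, (S i).Nonempty) :
    ∑ a, #(∑ i ∈ 𝒜 a, S i) ≤ k * (#(∑ i, S i) - 1) + Fintype.card ι := by
  obtain ⟨E, -, hsub, hle⟩ := sum_card_subsum_le_of_isUniformCover 𝒜 h𝒜 S hS
  exact hle.trans (Nat.add_le_add_right (Nat.mul_le_mul_left _
    (Nat.sub_le_sub_right (card_le_card hsub) _)) _)

end UniformCoverSuperadditivity

section UniformCoverSuperadditivityTorsionFree

open UniformCover
open scoped Pointwise

/-- The image of a sum of finsets under an additive map is the sum of the images. [folklore] -/
private theorem image_finsetSum_addMonoidHom {H K : Type*} [AddCommMonoid H] [AddCommMonoid K]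
    [DecidableEq H] [DecidableEq K] {ι : Type*} (φ : H →+ K) (B : ι → Finset H) (T : Finset ι) :
    (∑ j ∈ T, B j).image φ = ∑ j ∈ T, (B j).image φ := by
  classical
  induction T using Finset.induction_on with
  | empty => simp only [sum_empty, Finset.image_zero, map_zero]; rfl
  | insert a T haT ih => rw [sum_insert haT, sum_insert haT, image_add, ih]

/-- The image of `S′ = ⋃_A (S_A + ∑_{i∉A} E_i)` under an additive map. [folklore] -/
private theorem image_biUnion_subsum_add {H K : Type*} [AddCommMonoid H] [AddCommMonoid K]
    [DecidableEq H] [DecidableEq K] {ι : Type*} [Fintype ι] {n : ℕ} (φ : H →+ K)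
    (𝒜 : ι → Finset (Fin n)) (B E : Fin n → Finset H) :
    (univ.biUnion fun a => (∑ i ∈ 𝒜 a, B i) + ∑ i ∈ (𝒜 a)ᶜ, E i).image φ =
      univ.biUnion fun a => (∑ i ∈ 𝒜 a, (B i).image φ) + ∑ i ∈ (𝒜 a)ᶜ, (E i).image φ := by
  rw [biUnion_image]
  refine biUnion_congr rfl fun a _ => ?_
  rw [image_add, image_finsetSum_addMonoidHom, image_finsetSum_addMonoidHom]

/-- **Balister–Bollobás 2012, Theorem 10** (as printed, torsion-free abelian groups).  "If the
sets `S_i` lie in a torsion-free abelian group then there are subsets `S′_i ⊆ S_i` of cardinality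
at most `2` such that for any uniform `k`-cover `𝒜` of `[n]` we have
`k(|S| − 1) ≥ k(|S′| − 1) ≥ ∑_{A∈𝒜} (|S_A| − 1)`, where `S′` is the set of sums `s₁ + ⋯ + s_n ∈ S`
such that `{i : s_i ∉ S′_i} ⊆ A` for some `A ∈ 𝒜`" — here `S′ = ⋃_{A∈𝒜} (S_A + ∑_{i∉A} S′_i)`,
the conclusion written `S′ ⊆ S` and `∑_{A∈𝒜} |S_A| ≤ k(|S′| − 1) + |𝒜|` (all `S_i` non-empty, so
every `|S_A| ≥ 1`).  Printed proof: "any torsion-free abelian group can be given an ordering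
compatible with addition", then the marking argument (`sum_card_subsum_le_of_isUniformCover`).
Here (the road of `gmr_superadditivity_of_isAddTorsionFree`): the subgroup generated by the `S_i`
is a finitely generated torsion-free `ℤ`-module, hence free (`Module.basisOfFiniteTypeTorsionFree'`),
hence embeds additively in the linearly ordered group `Lex (Fin d → ℤ)`; all the set sizes involved
are preserved by injective additive maps.  `S′_i` is the pull-back of `{min, max}` for that order,
chosen before (independently of) the cover, as printed. [cite: BalisterBollobas2012, Thm 10] -/
theorem exists_pair_subsets_sum_card_subsum_le {G : Type*} [AddCommGroup G] [DecidableEq G]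
    [IsAddTorsionFree G] {n : ℕ} (S : Fin n → Finset G) (hS : ∀ i, (S i).Nonempty) :
    ∃ E : Fin n → Finset G, (∀ i, E i ⊆ S i ∧ #(E i) ≤ 2) ∧
      ∀ (ι : Type*) [Fintype ι] (k : ℕ) (𝒜 : ι → Finset (Fin n)), IsUniformCover k 𝒜 →
        (univ.biUnion fun a => (∑ i ∈ 𝒜 a, S i) + ∑ i ∈ (𝒜 a)ᶜ, E i) ⊆ ∑ i, S i ∧
        ∑ a, #(∑ i ∈ 𝒜 a, S i) ≤
          k * (#(univ.biUnion fun a => (∑ i ∈ 𝒜 a, S i) + ∑ i ∈ (𝒜 a)ᶜ, E i) - 1) +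
            Fintype.card ι := by
  classical
  -- the subgroup generated by all the summands: a finitely generated torsion-free `ℤ`-module, free
  set s : Finset G := univ.biUnion S with hs
  set P : Submodule ℤ G := Submodule.span ℤ (s : Set G) with hP
  have hSP : ∀ i, ∀ x ∈ S i, x ∈ P := fun i x hx =>
    Submodule.subset_span (by
      rw [hs, coe_biUnion]
      exact Set.mem_biUnion (mem_coe.2 (mem_univ i)) hx)
  haveI : Module.Finite ℤ P := Module.Finite.iff_fg.mpr ⟨s, rfl⟩
  obtain ⟨d, b⟩ := Module.basisOfFiniteTypeTorsionFree' (R := ℤ) (M := P)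
  -- the injective additive maps `P → Lex (Fin d → ℤ)` and `P → G`
  let ψ : P →+ Lex (Fin d → ℤ) :=
    { toFun := fun x => toLex (b.equivFun x)
      map_zero' := by simp
      map_add' := fun x y => by simp [toLex_add] }
  have hψ : Function.Injective ψ := fun x y hxy => b.equivFun.injective (toLex.injective hxy)
  let val : P →+ G :=
    { toFun := Subtype.val
      map_zero' := rfl
      map_add' := fun _ _ => rfl }
  have hval : Function.Injective val := Subtype.val_injective
  -- the summands lifted to `P`, and pushed into the ordered group
  set B : Fin n → Finset P := fun i => (S i).subtype (· ∈ P) with hB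
  have hBS : ∀ i, (B i).image val = S i := by
    intro i
    ext x
    simp only [hB, mem_image, Finset.mem_subtype]
    constructor
    · rintro ⟨y, hy, rfl⟩; exact hy
    · intro hx; exact ⟨⟨x, hSP i x hx⟩, hx, rfl⟩
  have hB_ne : ∀ i, (B i).Nonempty := fun i => by
    obtain ⟨x, hx⟩ := hS i
    exact ⟨⟨x, hSP i x hx⟩, by simp only [hB, Finset.mem_subtype]; exact hx⟩
  letI : DecidableEq (Lex (Fin d → ℤ)) := LinearOrder.toDecidableEq
  set C : Fin n → Finset (Lex (Fin d → ℤ)) := fun i => (B i).image ψ with hC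
  have hC_ne : ∀ i, (C i).Nonempty := fun i => (hB_ne i).image _
  -- the two-element sets `{min, max}` in the ordered group, pulled back to `P` and to `G`
  set EL : Fin n → Finset (Lex (Fin d → ℤ)) := fun i => {(C i).min' (hC_ne i), (C i).max' (hC_ne i)}
    with hEL
  have hELC : ∀ i, EL i ⊆ C i := by
    intro i z hz
    rw [hEL, mem_insert, mem_singleton] at hz
    rcases hz with rfl | rfl
    · exact min'_mem _ _
    · exact max'_mem _ _
  set EP : Fin n → Finset P := fun i => (B i).filter (fun x => ψ x ∈ EL i) with hEP
  have hEPψ : ∀ i, (EP i).image ψ = EL i := by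
    intro i
    ext z
    simp only [hEP, mem_image, mem_filter]
    constructor
    · rintro ⟨x, ⟨-, hxE⟩, rfl⟩; exact hxE
    · intro hz
      have hzC := hELC i hz
      simp only [hC, mem_image] at hzC
      obtain ⟨x, hxB, rfl⟩ := hzC
      exact ⟨x, ⟨hxB, hz⟩, rfl⟩
  have hEPcard : ∀ i, #(EP i) ≤ 2 := by
    intro i
    rw [← card_image_of_injective (EP i) hψ, hEPψ i, hEL]
    exact card_le_two
  have hEPB : ∀ i, EP i ⊆ B i := fun i => filter_subset _ _
  refine ⟨fun i => (EP i).image val, fun i => ⟨?_, card_image_le.trans (hEPcard i)⟩, ?_⟩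
  · rw [← hBS i]
    exact image_subset_image (hEPB i)
  intro ι _ k 𝒜 h𝒜
  refine ⟨biUnion_subsum_add_subset_sum 𝒜 S _ fun i => ?_, ?_⟩
  · rw [← hBS i]
    exact image_subset_image (hEPB i)
  -- the ordered-group inequality for the `C i`, transported along `G ← P → Lex (Fin d → ℤ)`
  have hineq := sum_card_subsum_le_of_isUniformCover_core 𝒜 h𝒜 C EL hC_ne
    (fun i => mem_insert_self _ _) (fun i => mem_insert_of_mem (mem_singleton_self _))
  have eS : ∀ a, #(∑ i ∈ 𝒜 a, S i) = #(∑ i ∈ 𝒜 a, C i) := by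
    intro a
    rw [show ∑ i ∈ 𝒜 a, S i = ∑ i ∈ 𝒜 a, (B i).image val from
        sum_congr rfl fun i _ => (hBS i).symm,
      ← image_finsetSum_addMonoidHom val, card_image_of_injective _ hval,
      show ∑ i ∈ 𝒜 a, C i = ∑ i ∈ 𝒜 a, (B i).image ψ from rfl,
      ← image_finsetSum_addMonoidHom ψ, card_image_of_injective _ hψ]
  have eS' : #(univ.biUnion fun a => (∑ i ∈ 𝒜 a, S i) + ∑ i ∈ (𝒜 a)ᶜ, (EP i).image val) =
      #(univ.biUnion fun a => (∑ i ∈ 𝒜 a, C i) + ∑ i ∈ (𝒜 a)ᶜ, EL i) := by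
    have h1 : (univ.biUnion fun a => (∑ i ∈ 𝒜 a, S i) + ∑ i ∈ (𝒜 a)ᶜ, (EP i).image val) =
        univ.biUnion fun a =>
          (∑ i ∈ 𝒜 a, (B i).image val) + ∑ i ∈ (𝒜 a)ᶜ, (EP i).image val :=
      biUnion_congr rfl fun a _ => by rw [sum_congr rfl fun i _ => (hBS i).symm]
    have h2 : (univ.biUnion fun a => (∑ i ∈ 𝒜 a, C i) + ∑ i ∈ (𝒜 a)ᶜ, EL i) =
        univ.biUnion fun a =>
          (∑ i ∈ 𝒜 a, (B i).image ψ) + ∑ i ∈ (𝒜 a)ᶜ, (EP i).image ψ :=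
      biUnion_congr rfl fun a _ => by rw [sum_congr rfl fun i _ => (hEPψ i).symm]
    rw [h1, h2, ← image_biUnion_subsum_add val, card_image_of_injective _ hval,
      ← image_biUnion_subsum_add ψ, card_image_of_injective _ hψ]
  rw [sum_congr rfl fun a _ => eS a, eS']
  exact hineq

end UniformCoverSuperadditivityTorsionFree

/-! ## Theorem 13: the n-fold Cauchy–Davenport–Kemperman inequality via the minimum order

Appended 2026-08-27 (same seat): Balister–Bollobás 2012 §5 closes with the `1`-uniform cover
`{{1}, …, {n}}` — Theorem 12 (Cauchy–Davenport for `n` summands in `ℤ_p`; in the tree as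
`cauchy_davenport_finSum` in `DiasDaSilvaHamidoune.lean`) and Theorem 13 (Kemperman / Wehn, all
finite groups).  Source: `paper:arxiv-0711.1151` chunk p0009. -/

section MinOrder

open scoped Pointwise

/-- A list-sum of non-empty finsets is non-empty (any additive monoid). [folklore] -/
private theorem list_ofFn_sum_nonempty {G : Type*} [AddMonoid G] [DecidableEq G] :
    ∀ {n : ℕ} (S : Fin n → Finset G), (∀ i, (S i).Nonempty) → ((List.ofFn S).sum).Nonempty
  | 0, S, _ => by simp
  | n + 1, S, hS => by
    rw [List.ofFn_succ, List.sum_cons]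
    exact (hS 0).add (list_ofFn_sum_nonempty (fun i => S i.succ) fun i => hS i.succ)

/-- **Balister–Bollobás 2012, Theorem 13, as printed for ALL groups (Kemperman 1956 [K], Wehn [W];
DeVos).**  "If `S₁, …, S_n` are non-empty subsets of a finite group `G` and `S = S₁ ⋆ ⋯ ⋆ S_n`
(`⋆` denoting the group operation), then either `|S| ≥ p` or `|S| − 1 ≥ ∑_i (|S_i| − 1)`, where
`p` is the smallest prime dividing `|G|`."  Written additively for an arbitrary (not necessarily
commutative) additive group, the iterated sumset as the list sum `S₁ + (S₂ + (⋯ + S_n))`, and with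
Mathlib's `AddMonoid.minOrder G : ℕ∞` for `p` (the least order of a non-zero element; the least
prime divisor of `|G|` when `G` is finite, `⊤` when `G` is torsion-free):
`min (minOrder G) ((∑ |S_i|) − (n − 1)) ≤ |S₁ + ⋯ + S_n|`.  Proof: the printed induction from the
two-set inequality, which is Mathlib's `cauchy_davenport_minOrder_add`.
[cite: BalisterBollobas2012, Thm 13] -/
theorem min_minOrder_sub_le_card_listSum {G : Type*} [AddGroup G] [DecidableEq G] :
    ∀ {n : ℕ} (S : Fin n → Finset G), (∀ i, (S i).Nonempty) →
      min (AddMonoid.minOrder G) (((∑ i, #(S i)) - (n - 1) : ℕ) : ℕ∞) ≤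
        (#((List.ofFn S).sum) : ℕ∞)
  | 0, S, _ => by simp
  | n + 1, S, hS => by
    classical
    set p : ℕ∞ := AddMonoid.minOrder G with hp
    set T : Finset G := (List.ofFn fun i : Fin n => S i.succ).sum with hT
    have hTne : T.Nonempty := list_ofFn_sum_nonempty (fun i => S i.succ) fun i => hS i.succ
    have ih := min_minOrder_sub_le_card_listSum (fun i : Fin n => S i.succ) fun i => hS i.succ
    have h2 := cauchy_davenport_minOrder_add (hS 0) hTne
    have hsplit : (List.ofFn S).sum = S 0 + T := by rw [List.ofFn_succ, List.sum_cons]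
    have hcard : ∑ i, #(S i) = #(S 0) + ∑ i : Fin n, #(S i.succ) := Fin.sum_univ_succ _
    rw [hsplit, hcard]
    have hS0 : 1 ≤ #(S 0) := card_pos.2 (hS 0)
    have htail : n ≤ ∑ i : Fin n, #(S i.succ) := by
      calc n = ∑ _i : Fin n, 1 := by simp
        _ ≤ ∑ i : Fin n, #(S i.succ) := sum_le_sum fun i _ => card_pos.2 (hS i.succ)
    have hTle : #T ≤ #(S 0 + T) := card_le_card_add_left (hS 0)
    rcases le_total p (#(S 0 + T) : ℕ∞) with hle | hle
    · exact (min_le_left _ _).trans hle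
    · rcases hle.lt_or_eq with hlt | heq
      swap
      · rw [← heq]; exact min_le_left _ _
      have h2' : #(S 0) + #T - 1 ≤ #(S 0 + T) := by
        have := (min_le_iff.1 h2).resolve_left (not_le.2 hlt)
        exact_mod_cast this
      have hTlt : (#T : ℕ∞) < p := lt_of_le_of_lt (by exact_mod_cast hTle) hlt
      have ih' : (∑ i : Fin n, #(S i.succ)) - (n - 1) ≤ #T := by
        have := (min_le_iff.1 ih).resolve_left (not_le.2 hTlt)
        exact_mod_cast this
      refine (min_le_right _ _).trans ?_
      have hT1 : 1 ≤ #T := card_pos.2 hTne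
      have hσ0 : n = 0 → (∑ i : Fin n, #(S i.succ)) = 0 := by
        rintro rfl; simp
      have key : #(S 0) + (∑ i : Fin n, #(S i.succ)) - (n + 1 - 1) ≤ #(S 0 + T) := by
        generalize (∑ i : Fin n, #(S i.succ)) = σ at ih' htail hσ0 ⊢
        generalize #(S 0 + T) = a at h2' ⊢
        generalize #T = b at h2' ih' hT1
        generalize #(S 0) = c at h2' hS0 ⊢
        rcases Nat.eq_zero_or_pos n with hn | hn
        · have := hσ0 hn
          omega
        · omega
      exact_mod_cast key

/-- **Balister–Bollobás 2012, Theorem 13, commutative form** (the statement above with the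
iterated sumset written `∑ i, S i`): `min (minOrder G) ((∑ |S_i|) − (n − 1)) ≤ |S₁ + ⋯ + S_n|` for
non-empty finite sets in an additive commutative group. [cite: BalisterBollobas2012, Thm 13] -/
theorem min_minOrder_sub_le_card_sum {G : Type*} [AddCommGroup G] [DecidableEq G] :
    ∀ {n : ℕ} (S : Fin n → Finset G), (∀ i, (S i).Nonempty) →
      min (AddMonoid.minOrder G) (((∑ i, #(S i)) - (n - 1) : ℕ) : ℕ∞) ≤ (#(∑ i, S i) : ℕ∞) := by
  intro n S hS
  have h := min_minOrder_sub_le_card_listSum S hS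
  rwa [List.sum_ofFn] at h

end MinOrder

end Literature.Combinatorics.Additive
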